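import Summits.SmoothPoincare4.SmoothPoincare4.Theorems.ConvexBisectionAcyclicBisectionExistsHurwitzReduction
import Summits.SmoothPoincare4.SmoothPoincare4.Theorems.ConvexBisectionAcyclicBisectionExistsBeltPageClause
import Summits.SmoothPoincare4.SmoothPoincare4.Theorems.ConvexBisectionAcyclicBisectionExistsPicardLefschetzNode
import Summits.SmoothPoincare4.SmoothPoincare4.Theorems.ConvexBisectionAcyclicBisectionExistsHurwitzMoveRotation
import Literature.Topology.FourManifolds.PresentationHandlebodyFiveProofs
import HarnessLib

/-!
# N1 DESIGN (worker G4, lead c5, wave 6, 2026-08-17) — `stub_M2geo` (node N1 of NF4):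
# ONE signed Hurwitz move realised geometrically on fibred data (transfer form with the
# seam/belt dichotomy), line `modp-braid-orbits`, crux `ConvexBisection.AcyclicBisectionExists`
# (stmt-SmoothPoincare4-10508).  Registered text: `work/stubs/sig_stub_M2geo.txt`.

`lean check`: rc 0; ONE `sorry` (the geometric node `node_N1_move`); the top theorem
`n1_design` is the REGISTERED TEXT VERBATIM and is PROVED from the nodes:

  n1_design  (registered `stub_M2geo`)                      PROVED  (§5)
    ⇐ m2geo_of_transfer : (M2-T) → (M2-geo)                 PROVED  (§5; V4 `belt_pos` + `cover`)
    ⇐ n1_transfer       : node_N1_swap → (M2-T)             PROVED  (§4; `HurwitzStep` unpacked,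
                           re-indexing `Fin l'.length ≃ Fin l.length` by the swap of the two
                           positions, `reindexData`, the letters of `l'` computed against
                           `transvection_apply` — this pins the SIGN CONVENTION of the move)
    ⇐ node_N1_swap      : the adjacent swap on generalised fibred data      PROVED (§3) from
         node_N1_move ×3 (cross, rot, rot; chained through `G₀ ≫ G`, `Function.update` of the
         directions, `Option.elim` classes) + the `pageDir` angle bookkeeping of §3a
    ⇐ node_N1_move      : ONE handle dragged through a sector of pages      NODE (§2, the ONLY sorry)
         internal plan = (a) canonical comparison + shrink + split [tree],
                         (b) node_N1_rot = `helper_rotFlow_sector` (LANDED p164629, §1 PROVED by it),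
                         (c) N1-slice: the Kas slice "absorb the old handle, dig the new one" with
                             fibred top control (NEW construction of `MultiAttachmentData`),
                         (d) N1-mono: localisation of the seam embedding `σ = Ψ ∘ jA` at a deep
                             belt (page Dehn twist `t_γ^{∓tw}` up to fibred isotopy),
                         (e) class bookkeeping by N1a = `shadow_pageDehnTwist_eq_transvection`
                             (LANDED p157857) and twisting by `pageTwisting_transport_eq_of_fibred`.
  hs_of_n1 : (HS) for closed manifolds := `hurwitzStep_of_redecomposition n1_transfer`   PROVED
LANDED: §1 = `…HurwitzMoveRotation.lean` (p164629 ACCEPTED); §3a = `…HurwitzMoveAngles.lean` (p166280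
ACCEPTED, namespace `HurwitzMove`); §3 = `…HurwitzMoveSwap.lean` (p167830 ACCEPTED: `swap_of_move :
node_N1_move-text → node_N1_swap-text`); §4–§5 = `…HurwitzMoveTransferLink.lean`
(p167136 ACCEPTED: `transfer_of_swap'`, `hs_of_swap'`) on top of `…HurwitzMoveTransfer.lean` (p165490
ACCEPTED: `m2geo_of_transfer`, registered `helper_dichotomy_of_seamClause`; its `transfer_of_swap` takes
the SUPERSEDED swap text with literal `h' k = h k`, see (F6)).  IN THE TREE (all five files ACCEPTED):
`stub_M2geo := m2geo_of_transfer (transfer_of_swap' (swap_of_move node_N1_move))`,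
(HS) `:= hs_of_swap' (swap_of_move node_N1_move)`.

## FINDINGS (design level; numbers refer to the W6/X2 reports)

(F1) **ISO gives no data.**  W6's plan for the 4-dimensional side of N1 ("new data via ISO
`isMultiAttachment_of_linkIsotopyInBoundary_holds` / `isAttachment_lift_iff`") cannot serve the
dichotomy: every `MultiAttachmentData` reachable from `D` by the tree's tools (transport along
target or base diffeomorphisms, locality, split/cons, canonical comparison, `Classical.choice` of
an `IsMultiAttachment`) has `jA' = G ∘ D.jA ∘ Φ⁻¹` ("conjugate type"), and the seam clause
through `G` then forces the base map `Φ` to be ANGLE-PRESERVING on the seam — so no handle moves.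
X2 met the same wall for T3 (X2-REPORT §2.1).  The honest move RE-DIGS the handle: near the old
attaching circle the new `jA'` covers the old deep belt by plain base points (Gompf–Stipsicz §8.2
read through Kas: the new deep belt of the moved handle is the outward vanishing cycle along the
new arc, the old one becomes seam).  Hence sub-node (c) "Kas slice" is a genuine CONSTRUCTION of
data (the analogue of X1's dual data `D₂`, ≈ 1.5–2.5 kLoC), not an application of ISO.
(F2) **Even the free rotation needs the deep-belt model.**  Filling the slice requires matching
two trivialisations of an annulus bundle over the swept arc of angles; the obstruction is an
integer (power of the Dehn twist along the core in `MCG(A rel ∂) = ℤ`), which vanishes exactly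
because the old belt presents the page monodromy `t_γ^{∓tw}` — sub-node (d), needed for `rot`
as much as for `cross` (for `cross` it moreover yields the class change via N1a).
(F3) **The binding is never touched.**  A smooth fibred diffeomorphism of `∂ Base g` which is the
identity off a sector is the identity near the binding (its angle map is projectively linear at
`w = 0`; the lead's rigidity remark); consistently the Kas slice lives over
`(annulus around the core) × (swept arc)` inside the FLAT part, and outside the slice the new data
are `G ∘ D` with `G` the collar slide of an angle-preserving boundary diffeotopy.  This is why
`helper_rotFlow_sector` is exactly fibred only on `{‖w‖ ≥ δ}` and why that suffices.
(F4) **Interface.**  Chaining moves needs the page AND belt clauses as invariants; they are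
phrased THROUGH the accumulated diffeomorphism `G₀ : X₀ ≅ X` (boundary datum and `Ψ` stay on the
original piece `X₀`), so no transport of `BoundaryData` is needed and moves compose by
`Diffeomorph.trans`.  (M2-geo) ⇔ (M2-T) given V4 (`m2geo_of_transfer`, and W6's
`redecomposition_of_geometric_of_belt`).
(F5) **Sign audit point.**  `n1_transfer` kernel-checks that disjunct 1 of `HurwitzStep`
(`(a,b) ↦ (t_a^{ε_a} b, a)`) is "the clockwise-later handle `b` moves COUNTER-clockwise across the
belt page of `a` and becomes `transvection (a, ε_a) b`", disjunct 2 is "`a` moves clockwise across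
`b` and becomes `transvection (b, ¬ε_b) a`".  The geometric proof of `node_N1_move` must deliver
exactly this pairing (conventions (a)–(c) of `LefschetzBasePages.lean`; N1a's audited `s ↔ ±β`).

(F6) **Tubes must be allowed to shrink.**  A first version of the move/swap nodes reported the
untouched handles LITERALLY (`h' k = h k`); that is unsatisfiable in general: the tube
`range (h k).toFun` of a third handle is an arbitrary embedded copy of Kosinski's `T` (with fingers)
and may fill the target page of a moved handle up to a graph, so no new attaching circle of the
prescribed class avoids it and no `MultiAttachmentData` of the literal family exists.  The nodes
below report the untouched handles by pages/shadows/twistings only (the proof shrinks all tubes by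
locality, `IsMultiAttachment.of_eqOn_near_sphere` / `isMultiAttachment_shrink_iff`).

## NODE TABLE (sizes = honest estimates, lines of Lean, on top of the tree of 2026-08-17)

* node_N1_rot   `helper_rotFlow_sector`                    LANDED p164629 ACCEPTED (360 lines)
* node_N1_move  one handle through a sector (free / crossing one handle)   XL 2600–3900:
    (a) model replacement + shrink + split (data forms)          200–300
    (c) N1-slice  Kas slice, fibred top control                 1500–2500
    (d) N1-mono   deep-belt localisation of `σ`                  700–1100
    (e) class (N1a, landed) + twisting transport + assembly       200–300
* node_N1_swap  := move ×3 + `pageDir` angle bookkeeping          PROVED here (§3a–§3, ≈ 560 lines)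
* §4–§5 (this file, PROVED; landed copy p165490, 391 lines)        ≈ 330
TOTAL N1 ≈ 3.2–4.7 kLoC (W6: 2.5–4; the increase is (F1): the slice is a construction).
-/

noncomputable section

set_option linter.dupNamespace false

open scoped Manifold ContDiff Topology Real
open Set Function

namespace Summit.SmoothPoincare4.SmoothPoincare4.Theorems.AcyclicBisectionExists.ModpBraidOrbits

namespace N1Design

open Literature.GroupTheory.CombinatorialGroupTheory.SignedHurwitz
open Literature.Topology.FourManifolds Literature.Topology.FourManifolds.LefschetzBase
open Literature.Topology.FourManifolds.HandleAttachingMap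
open ModelsOnFibredOfReach

universe u

/-! ## §0 Bookkeeping (PROVED): lists, re-indexing of multi-attachment data -/

/-- A signed Hurwitz move keeps the length. [folklore] -/
theorem hurwitzStep_length {g : ℕ} {l l' : IntWord g} (h : HurwitzStep (stdSymp ℤ g) l l') :
    l'.length = l.length := by
  obtain ⟨pre, suf, a, b, rfl, h'⟩ := h
  rcases h' with rfl | rfl <;> simp

/-- Entries of `pre ++ x :: y :: suf` before the two distinguished positions. [folklore] -/
theorem getElem_mid_left {α : Type*} (pre suf : List α) (x y x' y' : α) {j : ℕ}
    (hj : j < pre.length) (h₁ : j < (pre ++ x :: y :: suf).length)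
    (h₂ : j < (pre ++ x' :: y' :: suf).length) :
    (pre ++ x :: y :: suf)[j] = (pre ++ x' :: y' :: suf)[j] := by
  rw [List.getElem_append_left hj, List.getElem_append_left hj]

/-- The entry at the first distinguished position. [folklore] -/
theorem getElem_mid_fst {α : Type*} (pre suf : List α) (x y : α)
    (h₁ : pre.length < (pre ++ x :: y :: suf).length) :
    (pre ++ x :: y :: suf)[pre.length] = x := by
  rw [List.getElem_append_right (le_refl _)]
  simp

/-- The entry at the second distinguished position. [folklore] -/
theorem getElem_mid_snd {α : Type*} (pre suf : List α) (x y : α)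
    (h₁ : pre.length + 1 < (pre ++ x :: y :: suf).length) :
    (pre ++ x :: y :: suf)[pre.length + 1] = y := by
  rw [List.getElem_append_right (Nat.le_succ _)]
  simp

/-- Entries after the two distinguished positions. [folklore] -/
theorem getElem_mid_right {α : Type*} (pre suf : List α) (x y x' y' : α) {j : ℕ}
    (hj : pre.length + 2 ≤ j) (h₁ : j < (pre ++ x :: y :: suf).length)
    (h₂ : j < (pre ++ x' :: y' :: suf).length) :
    (pre ++ x :: y :: suf)[j] = (pre ++ x' :: y' :: suf)[j] := by
  rw [List.getElem_append_right (by omega), List.getElem_append_right (by omega)]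
  obtain ⟨m, hm⟩ : ∃ m, j - pre.length = m + 2 := ⟨j - pre.length - 2, by omega⟩
  simp only [hm, List.getElem_cons_succ]

section Reindex

variable {n k : ℕ} {M : Type u} [TopologicalSpace M] [T2Space M]
  [ChartedSpace (EuclideanHalfSpace (n + 1)) M] [IsManifold (𝓡∂ (n + 1)) ∞ M]
  {ι ι' : Type*} [Finite ι] [Finite ι'] {h : ι → HandleAttachingMap n k M}
  {EP HP : Type*} [NormedAddCommGroup EP] [NormedSpace ℝ EP] [TopologicalSpace HP]
  {IP : ModelWithCorners ℝ EP HP} {P : Type*} [TopologicalSpace P] [ChartedSpace HP P]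

/-- **Re-indexing multi-attachment DATA along a bijection of the index types** (the data form
of the tree's `IsMultiAttachment.reindex`): same `M`-piece embedding (the cores are the same
set), handle embeddings `jB (e i')`. [folklore] -/
def reindexData (D : MultiAttachmentData h IP P) (e : ι' ≃ ι) : MultiAttachmentData (h ∘ e) IP P :=
  let Φ : ↥(coresComplement (h ∘ e)) ≃ₘ⟮𝓡∂ (n + 1), 𝓡∂ (n + 1)⟯ ↥(coresComplement h) :=
    opensCongr (Diffeomorph.refl (𝓡∂ (n + 1)) M ∞) _ _ fun _ =>
      mem_coresComplement_comp_iff e.surjective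
  { disjoint := fun i' j' hne => D.disjoint fun c => hne (e.injective c)
    jA := D.jA ∘ Φ
    jB := fun i' => D.jB (e i')
    hjA := D.hjA.comp_openPartialHomeomorph Φ.toHomeomorph.toOpenPartialHomeomorph rfl
      (Φ.contMDiff.contMDiffOn.congr fun _ _ => rfl)
      (Φ.symm.contMDiff.contMDiffOn.congr fun _ _ => rfl)
    hjAo := by
      have hr : range (D.jA ∘ Φ) = range D.jA := Φ.surjective.range_comp D.jA
      rw [hr]; exact D.hjAo
    hjB := fun i' => D.hjB (e i')
    cover := by
      have hr : range (D.jA ∘ Φ) = range D.jA := Φ.surjective.range_comp D.jA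
      have hU : (⋃ i', range (D.jB (e i'))) = ⋃ i, range (D.jB i) :=
        e.surjective.iUnion_comp fun i => range (D.jB i)
      rw [hr, hU]; exact D.cover
    glue := fun i' a b => by
      rw [Function.comp_apply, D.glue (e i') (Φ a) b, Function.comp_apply]
      rfl
    disjointB := fun i' j' hne => D.disjointB fun c => hne (e.injective c) }

/-- The `M`-piece embedding of re-indexed data is the old one (same underlying base point).
[folklore] -/
theorem reindexData_jA (D : MultiAttachmentData h IP P) (e : ι' ≃ ι)
    (a : ↥(coresComplement (h ∘ e))) :
    (reindexData D e).jA a = D.jA ⟨(a : M), (mem_coresComplement_comp_iff e.surjective).1 a.2⟩ :=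
  rfl

/-- The range of the `M`-piece embedding is unchanged by re-indexing. [folklore] -/
theorem range_reindexData_jA (D : MultiAttachmentData h IP P) (e : ι' ≃ ι) :
    range (reindexData D e).jA = range D.jA := by
  ext p
  constructor
  · rintro ⟨a, rfl⟩; exact ⟨_, (reindexData_jA D e a).symm⟩
  · rintro ⟨a, rfl⟩
    exact ⟨⟨(a : M), (mem_coresComplement_comp_iff e.surjective).2 a.2⟩, rfl⟩

end Reindex

/-! ## §1 node N1-rot (LANDED by this worker): the sector-supported fibred page rotation -/

/-- **N1-rot — the sector-supported, exactly fibred page rotation of `Base g`** (registered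
`helper_rotFlow_sector`, file `…Theorems/ConvexBisectionAcyclicBisectionExistsHurwitzMoveRotation.lean`,
proposal p164629 ACCEPTED, commit 9dfbf5f3596d; text = `work/stubs/sig_helper_rotFlow_sector.txt`).  For a smooth angular speed
`B : ℂ → ℝ` (read on the page direction `w/‖w‖`) and `0 < δ ≤ 1/2`: an ambient isotopy `R` of
`Base g` preserving `rho`, the flat part and `‖w‖`; fixing the directions where `B = 0` and the
binding; exactly fibred on `{‖w‖ ≥ δ}` (rays to rays, same ratio); flat pages to flat pages; rigid
rotation of the plateaux of `B`.  PROVED here by the landed `helper_rotFlow_sector` (module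
`…HurwitzMoveRotation`, built). [cite: GompfStipsicz1999, §8.2] -/
theorem node_N1_rot : ∀ (g : ℕ) (B : ℂ → ℝ), ContDiff ℝ ∞ B → ∀ (δ : ℝ), 0 < δ → δ ≤ 1 / 2 →
    ∃ R : AmbientIsotopy (𝓡∂ 4) (Base g),
      (∀ (t : ℝ) (x : Base g), rho g (R.toFun t x).1 = rho g x.1) ∧
      (∀ (t : ℝ) (x : Base g), ‖cx (R.toFun t x).1‖ ^ 2 < 4 ↔ ‖cx x.1‖ ^ 2 < 4) ∧
      (∀ (t : ℝ) (x : Base g), ‖w g (R.toFun t x).1‖ = ‖w g x.1‖) ∧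
      (∀ x : Base g, B (((‖w g x.1‖⁻¹ : ℝ) : ℂ) * w g x.1) = 0 → ∀ t : ℝ, R.toFun t x = x) ∧
      (∀ x : Base g, w g x.1 = 0 → ∀ t : ℝ, R.toFun t x = x) ∧
      (∀ x y : Base g, δ ≤ ‖w g x.1‖ → δ ≤ ‖w g y.1‖ → ∀ r : ℝ, 0 < r →
        w g y.1 = (r : ℂ) * w g x.1 → ∀ t : ℝ, w g (R.toFun t y).1 = (r : ℂ) * w g (R.toFun t x).1) ∧
      (∀ (t : ℝ) (c : ℂ), ‖c‖ = 1 → ∃ c' : ℂ, ‖c'‖ = 1 ∧ ∀ x : Base g, x ∈ page g c →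
        R.toFun t x ∈ page g c') ∧
      (∀ (κ φ₀ T : ℝ), (∀ s ∈ Set.Icc (0 : ℝ) T, B (Complex.exp (((φ₀ + κ * s : ℝ) : ℂ) * Complex.I)) = κ) →
        ∀ x : Base g, δ ≤ ‖w g x.1‖ →
          w g x.1 = ((‖w g x.1‖ : ℝ) : ℂ) * Complex.exp ((φ₀ : ℂ) * Complex.I) →
          ∀ t ∈ Set.Icc (0 : ℝ) T,
            w g (R.toFun t x).1 = ((‖w g x.1‖ : ℝ) : ℂ) * Complex.exp (((φ₀ + κ * t : ℝ) : ℂ) * Complex.I)) := by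
  exact helper_rotFlow_sector

/-! ## §2 node N1-move: ONE handle dragged through a sector of pages (free, or across one belt) -/

/-- **N1-move — one handle of a generalised Lefschetz link moved through a sector of pages, on
fibred data, transfer form.**  DATA: the original piece `X₀` with its boundary datum `bX` and the
page-preserving `Ψ : ∂X₀ ≅ ∂ Base g`; the current piece `X` with `G₀ : X₀ ≅ X`; a family `h` of
`n` attaching maps over `Base g` with cores in the flat pages of unit directions `d k`, shadows
`v k`, page twistings `∓1` coded by `s k`, and data `D` of `X`; the INVARIANTS, phrased through
`G₀`: the seam clause (a boundary point `G₀ (bX.incl y) = D.jA a` has `w (Ψ y) ∈ ℝ_{>0} w(a)`) and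
the belt clause (a deep belt point of handle `k` has `w (Ψ y) ∈ ℝ_{>0} d k`).  MOVE: handle `k₀`
is dragged by the signed angle `φ` (`0 < |φ| < 2π`; `φ > 0` counter-clockwise = the positive
normal direction of the pages) to the direction `d k₀ · e^{iφ}`; the closed swept arc contains no
other direction except, if `cross = some k₁`, the direction of ONE handle `k₁ ≠ k₀` strictly
inside.  OUTPUT: a new piece `X'`, the family `h'` (same pages, shadows and twistings off `k₀` — NOT
literally the old maps: all tubes may be shrunk, and must be, since a fat tube of a third handle may
fill the target page up to a graph; new core of `k₀` in the flat page of the target direction; shadow unchanged if free, `transvection (v k₁, s k₁)` of it if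
`k₁` is crossed counter-clockwise, `transvection (v k₁, ¬ s k₁)` if clockwise (Picard–Lefschetz:
crossing the belt page of `k₁` inside `∂X` applies its page monodromy `t^{±1}`); page twisting
unchanged), data `D'`, `G : X ≅ X'`, and the two invariants through `G₀ ≫ G` for the updated
directions.  Geometric content (Gompf–Stipsicz 1999 §8.2 on Kas' handlebody; FINDINGS (F1)–(F3)):
the critical value of `k₀` moves along an arc passing OUTSIDE the crossed critical value; Kas'
presentation re-read: outside a slice `(annulus around the core) × (swept arc)` of the flat part
the new data are `G ∘ D` with `G` the collar slide of the angle-preserving boundary diffeotopy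
`Ψ⁻¹ ∘ R ∘ Ψ` (`R` = `node_N1_rot`), inside the slice the old handle is absorbed and the new one
dug (N1-slice), the two trivialisations of the annulus bundle matched by the deep-belt model
(N1-mono), classes by N1a.  AUDIT POINT (F5): the pairing `φ > 0 ↔ s k₁`.  Size XL (2600–3900).
[cite: GompfStipsicz1999, §8.2] -/
theorem node_N1_move :
    ∀ (g n : ℕ) (X₀ : Type) [TopologicalSpace X₀] [T2Space X₀] [SecondCountableTopology X₀]
      [CompactSpace X₀] [ChartedSpace (EuclideanHalfSpace 4) X₀] [IsManifold (𝓡∂ 4) ∞ X₀]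
      (bX : BoundaryData (𝓡∂ 4) X₀ (𝓡 3)) (Ψ : bX.carrier ≃ₘ⟮𝓡 3, 𝓡 3⟯ (bBase g).carrier)
      (X : Type) [TopologicalSpace X] [T2Space X] [SecondCountableTopology X] [CompactSpace X]
      [ChartedSpace (EuclideanHalfSpace 4) X] [IsManifold (𝓡∂ 4) ∞ X]
      (G₀ : X₀ ≃ₘ⟮𝓡∂ 4, 𝓡∂ 4⟯ X)
      (h : Fin n → HandleAttachingMap 3 2 (Base g)) (D : MultiAttachmentData h (𝓡∂ 4) X)
      (d : Fin n → ℂ) (v : Fin n → (Fin g ⊕ Fin g → ℤ)) (s : Fin n → Bool),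
      (∀ k, ‖d k‖ = 1) →
      (∀ k θ, (h k).attachingCircle θ ∈ page g (d k)) →
      (∀ k, shadow g (h k).attachingCircle (h k).continuous_attachingCircle = v k) →
      (∀ k, pageTwisting g (h k).attachingCircle (h k).attachingFraming = if s k then -1 else 1) →
      (∀ (y : bX.carrier) (a : ↥(coresComplement h)), G₀ (bX.incl y) = D.jA a →
        ∃ c : ℝ, 0 < c ∧ w g ((bBase g).incl (Ψ y)).1 = (c : ℂ) * w g (a : Base g).1) →
      (∀ (y : bX.carrier) (k : Fin n) (b : ↥(beltPiece 3 2)), G₀ (bX.incl y) = D.jB k b →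
        G₀ (bX.incl y) ∉ range D.jA →
        ∃ c : ℝ, 0 < c ∧ w g ((bBase g).incl (Ψ y)).1 = (c : ℂ) * d k) →
      ∀ (k₀ : Fin n) (φ : ℝ) (cross : Option (Fin n)), φ ≠ 0 → |φ| < 2 * π →
      (∀ k, k ≠ k₀ → cross ≠ some k → ∀ t ∈ Set.Icc (0 : ℝ) 1,
        d k ≠ d k₀ * Complex.exp (((t * φ : ℝ) : ℂ) * Complex.I)) →
      (∀ k₁, cross = some k₁ → k₁ ≠ k₀ ∧
        (∃ t ∈ Set.Ioo (0 : ℝ) 1, d k₁ = d k₀ * Complex.exp (((t * φ : ℝ) : ℂ) * Complex.I))) →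
      ∃ (X' : Type) (_ : TopologicalSpace X') (_ : T2Space X') (_ : SecondCountableTopology X')
        (_ : CompactSpace X') (_ : ChartedSpace (EuclideanHalfSpace 4) X')
        (_ : IsManifold (𝓡∂ 4) ∞ X') (h' : Fin n → HandleAttachingMap 3 2 (Base g))
        (D' : MultiAttachmentData h' (𝓡∂ 4) X') (G : X ≃ₘ⟮𝓡∂ 4, 𝓡∂ 4⟯ X'),
        (∀ k θ, (h' k).attachingCircle θ ∈
          page g (Function.update d k₀ (d k₀ * Complex.exp ((φ : ℂ) * Complex.I)) k)) ∧
        (∀ k, shadow g (h' k).attachingCircle (h' k).continuous_attachingCircle =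
          Function.update v k₀ (Option.elim cross (v k₀)
            (fun k₁ => transvection (stdSymp ℤ g) (v k₁, if 0 < φ then s k₁ else !s k₁) (v k₀))) k) ∧
        (∀ k, pageTwisting g (h' k).attachingCircle (h' k).attachingFraming = (if s k then -1 else 1)) ∧
        (∀ (y : bX.carrier) (a' : ↥(coresComplement h')), (G₀.trans G) (bX.incl y) = D'.jA a' →
          ∃ c : ℝ, 0 < c ∧ w g ((bBase g).incl (Ψ y)).1 = (c : ℂ) * w g (a' : Base g).1) ∧
        (∀ (y : bX.carrier) (k : Fin n) (b : ↥(beltPiece 3 2)), (G₀.trans G) (bX.incl y) = D'.jB k b →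
          (G₀.trans G) (bX.incl y) ∉ range D'.jA →
          ∃ c : ℝ, 0 < c ∧ w g ((bBase g).incl (Ψ y)).1 =
            (c : ℂ) * Function.update d k₀ (d k₀ * Complex.exp ((φ : ℂ) * Complex.I)) k) := by
  sorry

/-! ## §3a (PROVED) Angle bookkeeping for the three moves of the swap -/

section Angles

/-- `pageDir` shifted by an angle. [folklore] -/
theorem pageDir_mul_exp_ofReal (n k : ℕ) (c : ℝ) :
    pageDir n k * Complex.exp ((c : ℂ) * Complex.I) =
      Complex.exp (((-(2 * π * (k + 1 / 2) / n) + c : ℝ) : ℂ) * Complex.I) := by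
  rw [pageDir, ← Complex.exp_add]
  congr 1
  push_cast
  ring

/-- `e^{ia} = e^{ib}` iff `a ≡ b (mod 2π)` (real `a`, `b`). [folklore] -/
theorem exp_mul_I_eq_iff {a b : ℝ} :
    Complex.exp ((a : ℂ) * Complex.I) = Complex.exp ((b : ℂ) * Complex.I) ↔
      ∃ m : ℤ, a = b + m * (2 * π) := by
  rw [Complex.exp_eq_exp_iff_exists_int]
  constructor
  · rintro ⟨m, hm⟩
    refine ⟨m, ?_⟩
    have := congrArg Complex.im hm
    simpa using this
  · rintro ⟨m, hm⟩
    refine ⟨m, ?_⟩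
    rw [hm]
    push_cast
    ring

/-- Reading an equation `pageDir n k = e^{i(θ_j + c)}` (`θ_j` the angle of `pageDir n j`):
`c n / 2π = j − k − n m` for an integer `m`. [folklore] -/
theorem exists_int_of_pageDir_eq {n : ℕ} (hn : 0 < n) (k j : ℕ) (c : ℝ)
    (h : pageDir n k = Complex.exp (((-(2 * π * (j + 1 / 2) / n) + c : ℝ) : ℂ) * Complex.I)) :
    ∃ m : ℤ, c * n / (2 * π) = (j : ℝ) - k - n * m := by
  rw [pageDir, exp_mul_I_eq_iff] at h
  obtain ⟨m, hm⟩ := h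
  refine ⟨m, ?_⟩
  have hn' : (n : ℝ) ≠ 0 := by exact_mod_cast hn.ne'
  have hπ : (π : ℝ) ≠ 0 := Real.pi_ne_zero
  field_simp
  field_simp at hm
  linarith

/-- `n m = d` with `|d| < n` forces `m = 0`. [folklore] -/
theorem int_eq_zero_of_mul_eq {n : ℕ} {m d : ℤ} (h : (n : ℤ) * m = d) (h₁ : -(n : ℤ) < d)
    (h₂ : d < n) : m = 0 := by
  rcases lt_trichotomy m 0 with hm | hm | hm
  · nlinarith
  · exact hm
  · nlinarith

/-- `n m = 1` resp. `= −1` is impossible for `n ≥ 2`. [folklore] -/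
theorem int_mul_ne_of_two_le {n : ℕ} (hn : 2 ≤ n) (m : ℤ) (u : ℤ) (hu : u = 1 ∨ u = -1) :
    (n : ℤ) * m ≠ u := by
  intro h
  have hn' : (2 : ℤ) ≤ n := by exact_mod_cast hn
  rcases lt_trichotomy m 0 with hm | hm | hm
  · rcases hu with rfl | rfl <;> nlinarith
  · subst hm; rcases hu with rfl | rfl <;> simp at h
  · rcases hu with rfl | rfl <;> nlinarith

variable {n i : ℕ}

/-- Move 1 (`up`): the arc from `pageDir n (i+1)` counter-clockwise by `3π/n` contains no
direction other than `pageDir n i` (at parameter `t = 2/3`). [folklore] -/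
theorem free_move1 (hi : i + 1 < n) (k : Fin n) (hkB : k ≠ ⟨i + 1, hi⟩)
    (hkA : k ≠ ⟨i, Nat.lt_of_succ_lt hi⟩) {t : ℝ} (ht : t ∈ Set.Icc (0 : ℝ) 1)
    (heq : pageDir n k = pageDir n (i + 1) * Complex.exp (((t * (3 * π / n) : ℝ) : ℂ) * Complex.I)) :
    False := by
  have hn : 0 < n := by omega
  rw [pageDir_mul_exp_ofReal] at heq
  obtain ⟨m, hm⟩ := exists_int_of_pageDir_eq hn k (i + 1) _ heq
  have hn' : (n : ℝ) ≠ 0 := by exact_mod_cast hn.ne'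
  have h3 : 3 * t = 2 * (((i : ℤ) + 1 - k - n * m : ℤ) : ℝ) := by
    push_cast at hm ⊢
    field_simp at hm
    linarith
  have hk := k.2
  have hb : (0 : ℤ) ≤ (i : ℤ) + 1 - k - n * m ∧ (i : ℤ) + 1 - k - n * m ≤ 1 := by
    constructor
    · have : (0 : ℝ) ≤ (((i : ℤ) + 1 - k - n * m : ℤ) : ℝ) := by linarith [ht.1]
      exact_mod_cast this
    · have : (((i : ℤ) + 1 - k - n * m : ℤ) : ℝ) < 2 := by linarith [ht.2]
      have : ((i : ℤ) + 1 - k - n * m : ℤ) < 2 := by exact_mod_cast this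
      omega
  rcases (show (i : ℤ) + 1 - k - n * m = 0 ∨ (i : ℤ) + 1 - k - n * m = 1 by omega) with h0 | h1
  · have hm0 := int_eq_zero_of_mul_eq (n := n) (m := m) (d := (i : ℤ) + 1 - k) (by linarith) (by omega) (by omega)
    subst hm0
    have e : ((k : ℕ) : ℤ) = i + 1 := by linarith [h0]
    exact hkB (Fin.ext (show (k : ℕ) = i + 1 by exact_mod_cast e))
  · have hm0 := int_eq_zero_of_mul_eq (n := n) (m := m) (d := (i : ℤ) - k) (by linarith) (by omega) (by omega)
    subst hm0
    have e : ((k : ℕ) : ℤ) = i := by linarith [h1]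
    exact hkA (Fin.ext (show (k : ℕ) = i by exact_mod_cast e))

/-- Move 1: the crossed direction `pageDir n i` sits at parameter `2/3` of the arc. [folklore] -/
theorem cross_move1 (hi : i + 1 < n) :
    pageDir n i = pageDir n (i + 1) * Complex.exp ((((2 / 3 : ℝ) * (3 * π / n) : ℝ) : ℂ) * Complex.I) := by
  have hn : (n : ℝ) ≠ 0 := by
    have h0 : 0 < n := by omega
    exact_mod_cast h0.ne'
  rw [pageDir_mul_exp_ofReal, pageDir]
  congr 1
  push_cast
  field_simp
  ring

/-- Move 2: the moved direction of handle `i+1` (`pageDir n (i+1)` turned by `3π/n`) is not on the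
clockwise arc of length `2π/n` from `pageDir n i`. [folklore] -/
theorem free_move2_B (hi : i + 1 < n) {t : ℝ} (ht : t ∈ Set.Icc (0 : ℝ) 1)
    (heq : pageDir n (i + 1) * Complex.exp (((3 * π / n : ℝ) : ℂ) * Complex.I) =
      pageDir n i * Complex.exp (((t * -(2 * π / n) : ℝ) : ℂ) * Complex.I)) : False := by
  have hn : 0 < n := by omega
  have hn2 : 2 ≤ n := by omega
  rw [pageDir_mul_exp_ofReal, pageDir_mul_exp_ofReal, exp_mul_I_eq_iff] at heq
  obtain ⟨m, hm⟩ := heq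
  have hn' : (n : ℝ) ≠ 0 := by exact_mod_cast hn.ne'
  have ht' : t = (((n : ℤ) * m : ℤ) : ℝ) - 1 / 2 := by
    field_simp at hm
    push_cast at hm ⊢
    have e2 : (2 : ℝ) * n * m = 2 * ((n : ℝ) * m) := by ring
    linarith
  have h1 : ((n : ℤ) * m : ℤ) = 1 := by
    have hlo : (0 : ℝ) < (((n : ℤ) * m : ℤ) : ℝ) := by linarith [ht.1]
    have hhi : (((n : ℤ) * m : ℤ) : ℝ) < 2 := by linarith [ht.2]
    have hlo' : (0 : ℤ) < (n : ℤ) * m := by exact_mod_cast hlo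
    have hhi' : (n : ℤ) * m < 2 := by exact_mod_cast hhi
    omega
  exact int_mul_ne_of_two_le hn2 m 1 (Or.inl rfl) h1

/-- Move 2: no unmoved direction on the closed clockwise arc of length `2π/n` from `pageDir n i`.
[folklore] -/
theorem free_move2_O (hi : i + 1 < n) (k : Fin n) (hkB : k ≠ ⟨i + 1, hi⟩)
    (hkA : k ≠ ⟨i, Nat.lt_of_succ_lt hi⟩) {t : ℝ} (ht : t ∈ Set.Icc (0 : ℝ) 1)
    (heq : pageDir n k = pageDir n i * Complex.exp (((t * -(2 * π / n) : ℝ) : ℂ) * Complex.I)) :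
    False := by
  have hn : 0 < n := by omega
  rw [pageDir_mul_exp_ofReal] at heq
  obtain ⟨m, hm⟩ := exists_int_of_pageDir_eq hn k i _ heq
  have hn' : (n : ℝ) ≠ 0 := by exact_mod_cast hn.ne'
  have ht' : t = (((k : ℤ) - i + n * m : ℤ) : ℝ) := by
    push_cast at hm ⊢
    field_simp at hm
    linarith
  have hk := k.2
  have hb : (0 : ℤ) ≤ (k : ℤ) - i + n * m ∧ (k : ℤ) - i + n * m ≤ 1 := by
    constructor
    · have : (0 : ℝ) ≤ (((k : ℤ) - i + n * m : ℤ) : ℝ) := by linarith [ht.1]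
      exact_mod_cast this
    · have : (((k : ℤ) - i + n * m : ℤ) : ℝ) ≤ 1 := by linarith [ht.2]
      exact_mod_cast this
  rcases (show (k : ℤ) - i + n * m = 0 ∨ (k : ℤ) - i + n * m = 1 by omega) with h0 | h1
  · have hm0 := int_eq_zero_of_mul_eq (n := n) (m := m) (d := (i : ℤ) - k) (by linarith) (by omega) (by omega)
    subst hm0
    have e : ((k : ℕ) : ℤ) = i := by linarith [h0]
    exact hkA (Fin.ext (show (k : ℕ) = i by exact_mod_cast e))
  · have hm0 := int_eq_zero_of_mul_eq (n := n) (m := m) (d := (i : ℤ) + 1 - k) (by linarith) (by omega) (by omega)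
    subst hm0
    have e : ((k : ℕ) : ℤ) = i + 1 := by linarith [h1]
    exact hkB (Fin.ext (show (k : ℕ) = i + 1 by exact_mod_cast e))

/-- Move 3: the direction `pageDir n i · e^{−2πi/n}` of the moved handle `i` is not on the closed
clockwise arc of length `π/n` from the turned direction of handle `i+1`. [folklore] -/
theorem free_move3_A (hi : i + 1 < n) {t : ℝ} (ht : t ∈ Set.Icc (0 : ℝ) 1)
    (heq : pageDir n i * Complex.exp (((-(2 * π / n) : ℝ) : ℂ) * Complex.I) =
      pageDir n (i + 1) * Complex.exp (((3 * π / n : ℝ) : ℂ) * Complex.I) *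
        Complex.exp (((t * -(π / n) : ℝ) : ℂ) * Complex.I)) : False := by
  have hn : 0 < n := by omega
  have hn2 : 2 ≤ n := by omega
  rw [pageDir_mul_exp_ofReal, pageDir_mul_exp_ofReal, ← Complex.exp_add, ← add_mul, ← Complex.ofReal_add,
    exp_mul_I_eq_iff] at heq
  obtain ⟨m, hm⟩ := heq
  have hn' : (n : ℝ) ≠ 0 := by exact_mod_cast hn.ne'
  have ht' : t = 2 * (((n : ℤ) * m : ℤ) : ℝ) + 3 := by
    field_simp at hm
    push_cast at hm ⊢
    have e2 : (2 : ℝ) * n * m = 2 * ((n : ℝ) * m) := by ring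
    linarith
  have h1 : ((n : ℤ) * m : ℤ) = -1 := by
    have hlo : (-2 : ℝ) < (((n : ℤ) * m : ℤ) : ℝ) := by linarith [ht.1]
    have hhi : (((n : ℤ) * m : ℤ) : ℝ) ≤ -1 := by linarith [ht.2]
    have hlo' : (-2 : ℤ) < (n : ℤ) * m := by exact_mod_cast hlo
    have hhi' : (n : ℤ) * m ≤ -1 := by exact_mod_cast hhi
    omega
  exact int_mul_ne_of_two_le hn2 m (-1) (Or.inr rfl) h1

/-- Move 3: no unmoved direction on that arc. [folklore] -/
theorem free_move3_O (hi : i + 1 < n) (k : Fin n) (_hkB : k ≠ ⟨i + 1, hi⟩)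
    (hkA : k ≠ ⟨i, Nat.lt_of_succ_lt hi⟩) {t : ℝ} (ht : t ∈ Set.Icc (0 : ℝ) 1)
    (heq : pageDir n k = pageDir n (i + 1) * Complex.exp (((3 * π / n : ℝ) : ℂ) * Complex.I) *
        Complex.exp (((t * -(π / n) : ℝ) : ℂ) * Complex.I)) : False := by
  have hn : 0 < n := by omega
  rw [pageDir_mul_exp_ofReal, ← Complex.exp_add, ← add_mul, ← Complex.ofReal_add, add_assoc] at heq
  obtain ⟨m, hm⟩ := exists_int_of_pageDir_eq hn k (i + 1) _ heq
  have hn' : (n : ℝ) ≠ 0 := by exact_mod_cast hn.ne'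
  have ht' : t = 3 - 2 * ((((i : ℤ) + 1 - k - n * m : ℤ) : ℝ)) := by
    push_cast at hm ⊢
    field_simp at hm
    linarith
  have hk := k.2
  have hJ : (i : ℤ) + 1 - k - n * m = 1 := by
    have hlo : (1 : ℝ) ≤ (((i : ℤ) + 1 - k - n * m : ℤ) : ℝ) := by linarith [ht.2]
    have hhi : (((i : ℤ) + 1 - k - n * m : ℤ) : ℝ) < 2 := by linarith [ht.1]
    have hlo' : (1 : ℤ) ≤ (i : ℤ) + 1 - k - n * m := by exact_mod_cast hlo
    have hhi' : (i : ℤ) + 1 - k - n * m < 2 := by exact_mod_cast hhi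
    omega
  have hm0 := int_eq_zero_of_mul_eq (n := n) (m := m) (d := (i : ℤ) - k) (by linarith) (by omega) (by omega)
  subst hm0
  have e : ((k : ℕ) : ℤ) = i := by linarith [hJ]
  exact hkA (Fin.ext (show (k : ℕ) = i by exact_mod_cast e))

/-- The final direction of handle `i+1`: `pageDir n (i+1)` turned by `3π/n` then by `−π/n` is
`pageDir n i`. [folklore] -/
theorem dir_move3 (hi : i + 1 < n) :
    pageDir n (i + 1) * Complex.exp (((3 * π / n : ℝ) : ℂ) * Complex.I) *
        Complex.exp (((-(π / n) : ℝ) : ℂ) * Complex.I) = pageDir n i := by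
  have hn : (n : ℝ) ≠ 0 := by
    have h0 : 0 < n := by omega
    exact_mod_cast h0.ne'
  rw [pageDir_mul_exp_ofReal, ← Complex.exp_add, pageDir]
  congr 1
  push_cast
  field_simp
  ring

/-- The final direction of handle `i`: `pageDir n i` turned by `−2π/n` is `pageDir n (i+1)`.
[folklore] -/
theorem dir_move2 (hi : i + 1 < n) :
    pageDir n i * Complex.exp (((-(2 * π / n) : ℝ) : ℂ) * Complex.I) = pageDir n (i + 1) := by
  have hn : (n : ℝ) ≠ 0 := by
    have h0 : 0 < n := by omega
    exact_mod_cast h0.ne'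
  rw [pageDir_mul_exp_ofReal, pageDir]
  congr 1
  push_cast
  field_simp
  ring

/-- Move 1 (`¬up`): the arc from `pageDir n i` clockwise by `3π/n` contains no direction other
than `pageDir n (i+1)`. [folklore] -/
theorem free_move1' (hi : i + 1 < n) (k : Fin n) (hkA : k ≠ ⟨i, Nat.lt_of_succ_lt hi⟩)
    (hkB : k ≠ ⟨i + 1, hi⟩) {t : ℝ} (ht : t ∈ Set.Icc (0 : ℝ) 1)
    (heq : pageDir n k = pageDir n i * Complex.exp (((t * -(3 * π / n) : ℝ) : ℂ) * Complex.I)) :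
    False := by
  have hn : 0 < n := by omega
  rw [pageDir_mul_exp_ofReal] at heq
  obtain ⟨m, hm⟩ := exists_int_of_pageDir_eq hn k i _ heq
  have hn' : (n : ℝ) ≠ 0 := by exact_mod_cast hn.ne'
  have h3 : 3 * t = 2 * ((((k : ℤ) - i + n * m : ℤ)) : ℝ) := by
    push_cast at hm ⊢
    field_simp at hm
    linarith
  have hk := k.2
  have hb : (0 : ℤ) ≤ (k : ℤ) - i + n * m ∧ (k : ℤ) - i + n * m ≤ 1 := by
    constructor
    · have : (0 : ℝ) ≤ (((k : ℤ) - i + n * m : ℤ) : ℝ) := by linarith [ht.1]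
      exact_mod_cast this
    · have : (((k : ℤ) - i + n * m : ℤ) : ℝ) < 2 := by linarith [ht.2]
      have : ((k : ℤ) - i + n * m : ℤ) < 2 := by exact_mod_cast this
      omega
  rcases (show (k : ℤ) - i + n * m = 0 ∨ (k : ℤ) - i + n * m = 1 by omega) with h0 | h1
  · have hm0 := int_eq_zero_of_mul_eq (n := n) (m := m) (d := (i : ℤ) - k) (by linarith) (by omega) (by omega)
    subst hm0
    have e : ((k : ℕ) : ℤ) = i := by linarith [h0]
    exact hkA (Fin.ext (show (k : ℕ) = i by exact_mod_cast e))
  · have hm0 := int_eq_zero_of_mul_eq (n := n) (m := m) (d := (i : ℤ) + 1 - k) (by linarith) (by omega) (by omega)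
    subst hm0
    have e : ((k : ℕ) : ℤ) = i + 1 := by linarith [h1]
    exact hkB (Fin.ext (show (k : ℕ) = i + 1 by exact_mod_cast e))

/-- Move 1 (`¬up`): the crossed direction `pageDir n (i+1)` sits at parameter `2/3`. [folklore] -/
theorem cross_move1' (hi : i + 1 < n) :
    pageDir n (i + 1) = pageDir n i * Complex.exp ((((2 / 3 : ℝ) * -(3 * π / n) : ℝ) : ℂ) * Complex.I) := by
  have hn : (n : ℝ) ≠ 0 := by
    have h0 : 0 < n := by omega
    exact_mod_cast h0.ne'
  rw [pageDir_mul_exp_ofReal, pageDir]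
  congr 1
  push_cast
  field_simp
  ring

/-- Move 2 (`¬up`): the moved direction of handle `i` is not on the counter-clockwise arc of
length `2π/n` from `pageDir n (i+1)`. [folklore] -/
theorem free_move2_B' (hi : i + 1 < n) {t : ℝ} (ht : t ∈ Set.Icc (0 : ℝ) 1)
    (heq : pageDir n i * Complex.exp (((-(3 * π / n) : ℝ) : ℂ) * Complex.I) =
      pageDir n (i + 1) * Complex.exp (((t * (2 * π / n) : ℝ) : ℂ) * Complex.I)) : False := by
  have hn : 0 < n := by omega
  have hn2 : 2 ≤ n := by omega
  rw [pageDir_mul_exp_ofReal, pageDir_mul_exp_ofReal, exp_mul_I_eq_iff] at heq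
  obtain ⟨m, hm⟩ := heq
  have hn' : (n : ℝ) ≠ 0 := by exact_mod_cast hn.ne'
  have ht' : t = -(((n : ℤ) * m : ℤ) : ℝ) - 1 / 2 := by
    field_simp at hm
    push_cast at hm ⊢
    have e2 : (2 : ℝ) * n * m = 2 * ((n : ℝ) * m) := by ring
    linarith
  have h1 : ((n : ℤ) * m : ℤ) = -1 := by
    have hlo : (-2 : ℝ) < (((n : ℤ) * m : ℤ) : ℝ) := by linarith [ht.2]
    have hhi : (((n : ℤ) * m : ℤ) : ℝ) < 0 := by linarith [ht.1]
    have hlo' : (-2 : ℤ) < (n : ℤ) * m := by exact_mod_cast hlo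
    have hhi' : (n : ℤ) * m < 0 := by exact_mod_cast hhi
    omega
  exact int_mul_ne_of_two_le hn2 m (-1) (Or.inr rfl) h1

/-- Move 2 (`¬up`): no unmoved direction on the closed counter-clockwise arc of length `2π/n`
from `pageDir n (i+1)`. [folklore] -/
theorem free_move2_O' (hi : i + 1 < n) (k : Fin n) (hkA : k ≠ ⟨i, Nat.lt_of_succ_lt hi⟩)
    (hkB : k ≠ ⟨i + 1, hi⟩) {t : ℝ} (ht : t ∈ Set.Icc (0 : ℝ) 1)
    (heq : pageDir n k = pageDir n (i + 1) * Complex.exp (((t * (2 * π / n) : ℝ) : ℂ) * Complex.I)) :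
    False := by
  have hn : 0 < n := by omega
  rw [pageDir_mul_exp_ofReal] at heq
  obtain ⟨m, hm⟩ := exists_int_of_pageDir_eq hn k (i + 1) _ heq
  have hn' : (n : ℝ) ≠ 0 := by exact_mod_cast hn.ne'
  have ht' : t = ((((i : ℤ) + 1 - k - n * m : ℤ)) : ℝ) := by
    push_cast at hm ⊢
    field_simp at hm
    linarith
  have hk := k.2
  have hb : (0 : ℤ) ≤ (i : ℤ) + 1 - k - n * m ∧ (i : ℤ) + 1 - k - n * m ≤ 1 := by
    constructor
    · have : (0 : ℝ) ≤ (((i : ℤ) + 1 - k - n * m : ℤ) : ℝ) := by linarith [ht.1]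
      exact_mod_cast this
    · have : (((i : ℤ) + 1 - k - n * m : ℤ) : ℝ) ≤ 1 := by linarith [ht.2]
      exact_mod_cast this
  rcases (show (i : ℤ) + 1 - k - n * m = 0 ∨ (i : ℤ) + 1 - k - n * m = 1 by omega) with h0 | h1
  · have hm0 := int_eq_zero_of_mul_eq (n := n) (m := m) (d := (i : ℤ) + 1 - k) (by linarith) (by omega) (by omega)
    subst hm0
    have e : ((k : ℕ) : ℤ) = i + 1 := by linarith [h0]
    exact hkB (Fin.ext (show (k : ℕ) = i + 1 by exact_mod_cast e))
  · have hm0 := int_eq_zero_of_mul_eq (n := n) (m := m) (d := (i : ℤ) - k) (by linarith) (by omega) (by omega)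
    subst hm0
    have e : ((k : ℕ) : ℤ) = i := by linarith [h1]
    exact hkA (Fin.ext (show (k : ℕ) = i by exact_mod_cast e))

/-- Move 3 (`¬up`): the direction `pageDir n (i+1) · e^{2πi/n}` of the moved handle `i+1` is not
on the closed counter-clockwise arc of length `π/n` from the turned direction of handle `i`.
[folklore] -/
theorem free_move3_A' (hi : i + 1 < n) {t : ℝ} (ht : t ∈ Set.Icc (0 : ℝ) 1)
    (heq : pageDir n (i + 1) * Complex.exp (((2 * π / n : ℝ) : ℂ) * Complex.I) =
      pageDir n i * Complex.exp (((-(3 * π / n) : ℝ) : ℂ) * Complex.I) *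
        Complex.exp (((t * (π / n) : ℝ) : ℂ) * Complex.I)) : False := by
  have hn : 0 < n := by omega
  have hn2 : 2 ≤ n := by omega
  rw [pageDir_mul_exp_ofReal, pageDir_mul_exp_ofReal, ← Complex.exp_add, ← add_mul, ← Complex.ofReal_add,
    exp_mul_I_eq_iff] at heq
  obtain ⟨m, hm⟩ := heq
  have hn' : (n : ℝ) ≠ 0 := by exact_mod_cast hn.ne'
  have ht' : t = 3 - 2 * (((n : ℤ) * m : ℤ) : ℝ) := by
    field_simp at hm
    push_cast at hm ⊢
    have e2 : (2 : ℝ) * n * m = 2 * ((n : ℝ) * m) := by ring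
    linarith
  have h1 : ((n : ℤ) * m : ℤ) = 1 := by
    have hlo : (1 : ℝ) ≤ (((n : ℤ) * m : ℤ) : ℝ) := by linarith [ht.2]
    have hhi : (((n : ℤ) * m : ℤ) : ℝ) < 2 := by linarith [ht.1]
    have hlo' : (1 : ℤ) ≤ (n : ℤ) * m := by exact_mod_cast hlo
    have hhi' : (n : ℤ) * m < 2 := by exact_mod_cast hhi
    omega
  exact int_mul_ne_of_two_le hn2 m 1 (Or.inl rfl) h1

/-- Move 3 (`¬up`): no unmoved direction on that arc. [folklore] -/
theorem free_move3_O' (hi : i + 1 < n) (k : Fin n) (_hkA : k ≠ ⟨i, Nat.lt_of_succ_lt hi⟩)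
    (hkB : k ≠ ⟨i + 1, hi⟩) {t : ℝ} (ht : t ∈ Set.Icc (0 : ℝ) 1)
    (heq : pageDir n k = pageDir n i * Complex.exp (((-(3 * π / n) : ℝ) : ℂ) * Complex.I) *
        Complex.exp (((t * (π / n) : ℝ) : ℂ) * Complex.I)) : False := by
  have hn : 0 < n := by omega
  rw [pageDir_mul_exp_ofReal, ← Complex.exp_add, ← add_mul, ← Complex.ofReal_add, add_assoc] at heq
  obtain ⟨m, hm⟩ := exists_int_of_pageDir_eq hn k i _ heq
  have hn' : (n : ℝ) ≠ 0 := by exact_mod_cast hn.ne'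
  have ht' : t = 3 + 2 * ((((i : ℤ) - k - n * m : ℤ) : ℝ)) := by
    push_cast at hm ⊢
    field_simp at hm
    linarith
  have hk := k.2
  have hJ : (i : ℤ) - k - n * m = -1 := by
    have hlo : (-2 : ℝ) < (((i : ℤ) - k - n * m : ℤ) : ℝ) := by linarith [ht.1]
    have hhi : (((i : ℤ) - k - n * m : ℤ) : ℝ) ≤ -1 := by linarith [ht.2]
    have hlo' : (-2 : ℤ) < (i : ℤ) - k - n * m := by exact_mod_cast hlo
    have hhi' : (i : ℤ) - k - n * m ≤ -1 := by exact_mod_cast hhi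
    omega
  have hm0 := int_eq_zero_of_mul_eq (n := n) (m := m) (d := (i : ℤ) + 1 - k) (by linarith) (by omega) (by omega)
  subst hm0
  have e : ((k : ℕ) : ℤ) = i + 1 := by linarith [hJ]
  exact hkB (Fin.ext (show (k : ℕ) = i + 1 by exact_mod_cast e))

/-- The final direction of handle `i` (`¬up`). [folklore] -/
theorem dir_move3' (hi : i + 1 < n) :
    pageDir n i * Complex.exp (((-(3 * π / n) : ℝ) : ℂ) * Complex.I) *
        Complex.exp (((π / n : ℝ) : ℂ) * Complex.I) = pageDir n (i + 1) := by
  have hn : (n : ℝ) ≠ 0 := by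
    have h0 : 0 < n := by omega
    exact_mod_cast h0.ne'
  rw [pageDir_mul_exp_ofReal, ← Complex.exp_add, pageDir]
  congr 1
  push_cast
  field_simp
  ring

/-- The final direction of handle `i+1` (`¬up`). [folklore] -/
theorem dir_move2' (hi : i + 1 < n) :
    pageDir n (i + 1) * Complex.exp (((2 * π / n : ℝ) : ℂ) * Complex.I) = pageDir n i := by
  have hn : (n : ℝ) ≠ 0 := by
    have h0 : 0 < n := by omega
    exact_mod_cast h0.ne'
  rw [pageDir_mul_exp_ofReal, pageDir]
  congr 1
  push_cast
  field_simp
  ring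

end Angles

/-! ## §3 node N1-swap: the adjacent swap (one signed Hurwitz move on OLD indices) -/

/-- **N1-swap — the two adjacent handles `i`, `i+1` of a Lefschetz-type link exchanged, transfer
form.**  DATA: fibred data `(X, h, D, bX, Ψ)` of a family of `n` handles with cores in the flat
pages of the standard directions `pageDir n k`, shadows `v k`, twistings coded by `s k`, the seam
clause and the belt clause.  For `i + 1 < n` and `up : Bool`:
* `up = true` (disjunct 1 of `HurwitzStep`): handle `i+1` (clockwise-later, direction
  `pageDir n (i+1)`) moves COUNTER-clockwise across the belt page of handle `i` to a direction just
  past `pageDir n i`, handle `i` rotates clockwise (freely) to `pageDir n (i+1)`, handle `i+1`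
  rotates back to `pageDir n i`; classes: position `i` ← `transvection (v i, s i) (v (i+1))`,
  position `i+1` ← `v i`;
* `up = false` (disjunct 2): handle `i` moves CLOCKWISE across the belt page of `i+1`, then the two
  free rotations; classes: position `i` ← `v (i+1)`, position `i+1` ←
  `transvection (v (i+1), ¬ s (i+1)) (v i)`.
OUTPUT (old indexing): `X'`, `h'` (same pages and shadows off `{i, i+1}`, all twistings kept,
tubes possibly shrunk; `h' (i+1)` in the page of `pageDir n i`, `h' i` in that of `pageDir n (i+1)`,
with the classes above),
`D'`, `G : X ≅ X'` and the seam clause through `G`.  Internal plan: `node_N1_move` three times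
(`φ₁ = +(2π/n + η)` crossing `i` resp. `φ₁ = −(2π/n + η)` crossing `i+1`, `η < 2π/n`; then
`φ₂ = ∓2π/n` free; then `φ₃ = ∓η` free) with `G₀ := refl, G₁, G₁ ≫ G₂`, the freeness of the arcs
from `pageDir n k = e^{−2πi(k+½)/n}` (`exp` equal iff angles differ by `2πℤ`, as in W6's
`pageDir_injOn`), and the final belt clause dropped.  Size: 250–400 lines on top of
`node_N1_move`. [cite: GompfStipsicz1999, §8.2] -/
theorem node_N1_swap :
    ∀ (g n : ℕ) (X : Type) [TopologicalSpace X] [T2Space X] [SecondCountableTopology X]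
      [CompactSpace X] [ChartedSpace (EuclideanHalfSpace 4) X] [IsManifold (𝓡∂ 4) ∞ X]
      (h : Fin n → HandleAttachingMap 3 2 (Base g)) (D : MultiAttachmentData h (𝓡∂ 4) X)
      (bX : BoundaryData (𝓡∂ 4) X (𝓡 3)) (Ψ : bX.carrier ≃ₘ⟮𝓡 3, 𝓡 3⟯ (bBase g).carrier)
      (v : Fin n → (Fin g ⊕ Fin g → ℤ)) (s : Fin n → Bool),
      (∀ (k : Fin n) θ, (h k).attachingCircle θ ∈ page g (pageDir n k)) →
      (∀ k, shadow g (h k).attachingCircle (h k).continuous_attachingCircle = v k) →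
      (∀ k, pageTwisting g (h k).attachingCircle (h k).attachingFraming = if s k then -1 else 1) →
      (∀ (y : bX.carrier) (a : ↥(coresComplement h)), bX.incl y = D.jA a →
        ∃ c : ℝ, 0 < c ∧ w g ((bBase g).incl (Ψ y)).1 = (c : ℂ) * w g (a : Base g).1) →
      (∀ (y : bX.carrier) (k : Fin n) (b : ↥(beltPiece 3 2)), bX.incl y = D.jB k b →
        bX.incl y ∉ range D.jA →
        ∃ c : ℝ, 0 < c ∧ w g ((bBase g).incl (Ψ y)).1 = (c : ℂ) * pageDir n k) →
      ∀ (i : ℕ) (hi : i + 1 < n) (up : Bool),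
      ∃ (X' : Type) (_ : TopologicalSpace X') (_ : T2Space X') (_ : SecondCountableTopology X')
        (_ : CompactSpace X') (_ : ChartedSpace (EuclideanHalfSpace 4) X')
        (_ : IsManifold (𝓡∂ 4) ∞ X') (h' : Fin n → HandleAttachingMap 3 2 (Base g))
        (D' : MultiAttachmentData h' (𝓡∂ 4) X') (G : X ≃ₘ⟮𝓡∂ 4, 𝓡∂ 4⟯ X'),
        (∀ k : Fin n, k.1 ≠ i → k.1 ≠ i + 1 → ∀ θ, (h' k).attachingCircle θ ∈ page g (pageDir n k)) ∧
        (∀ θ, (h' ⟨i + 1, hi⟩).attachingCircle θ ∈ page g (pageDir n i)) ∧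
        (∀ θ, (h' ⟨i, Nat.lt_of_succ_lt hi⟩).attachingCircle θ ∈ page g (pageDir n (i + 1))) ∧
        (∀ k : Fin n, k.1 ≠ i → k.1 ≠ i + 1 →
          shadow g (h' k).attachingCircle (h' k).continuous_attachingCircle = v k) ∧
        shadow g (h' ⟨i + 1, hi⟩).attachingCircle (h' ⟨i + 1, hi⟩).continuous_attachingCircle =
          (if up then transvection (stdSymp ℤ g) (v ⟨i, Nat.lt_of_succ_lt hi⟩, s ⟨i, Nat.lt_of_succ_lt hi⟩)
            (v ⟨i + 1, hi⟩) else v ⟨i + 1, hi⟩) ∧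
        shadow g (h' ⟨i, Nat.lt_of_succ_lt hi⟩).attachingCircle
            (h' ⟨i, Nat.lt_of_succ_lt hi⟩).continuous_attachingCircle =
          (if up then v ⟨i, Nat.lt_of_succ_lt hi⟩ else
            transvection (stdSymp ℤ g) (v ⟨i + 1, hi⟩, !s ⟨i + 1, hi⟩) (v ⟨i, Nat.lt_of_succ_lt hi⟩)) ∧
        (∀ k : Fin n, pageTwisting g (h' k).attachingCircle (h' k).attachingFraming = if s k then -1 else 1) ∧
        (∀ (y : bX.carrier) (a' : ↥(coresComplement h')), G (bX.incl y) = D'.jA a' →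
          ∃ c : ℝ, 0 < c ∧ w g ((bBase g).incl (Ψ y)).1 = (c : ℂ) * w g (a' : Base g).1) := by
  intro g n X _ _ _ _ _ _ h D bX Ψ v s hpage_k hshadow htw hseam hbelt i hi up
  have hiA : i < n := Nat.lt_of_succ_lt hi
  have hn2 : 2 ≤ n := by omega
  have hn2r : (2 : ℝ) ≤ n := by exact_mod_cast hn2
  have hnpos : (0 : ℝ) < n := by linarith
  have hAB : (⟨i, hiA⟩ : Fin n) ≠ ⟨i + 1, hi⟩ := fun c => by simp [Fin.ext_iff] at c
  have hBA : (⟨i + 1, hi⟩ : Fin n) ≠ ⟨i, hiA⟩ := fun c => hAB c.symm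
  -- the invariants through `refl`
  have hseam0 : ∀ (y : bX.carrier) (a : ↥(coresComplement h)),
      (Diffeomorph.refl (𝓡∂ 4) X ∞) (bX.incl y) = D.jA a →
      ∃ c : ℝ, 0 < c ∧ w g ((bBase g).incl (Ψ y)).1 = (c : ℂ) * w g (a : Base g).1 :=
    fun y a hy => hseam y a hy
  have hbelt0 : ∀ (y : bX.carrier) (k : Fin n) (b : ↥(beltPiece 3 2)),
      (Diffeomorph.refl (𝓡∂ 4) X ∞) (bX.incl y) = D.jB k b →
      (Diffeomorph.refl (𝓡∂ 4) X ∞) (bX.incl y) ∉ range D.jA →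
      ∃ c : ℝ, 0 < c ∧ w g ((bBase g).incl (Ψ y)).1 = (c : ℂ) * (fun k : Fin n => pageDir n ↑k) k :=
    fun y k b hy hd => hbelt y k b hy hd
  cases up with
  | true =>
    -- MOVE 1: handle ⟨i + 1, hi⟩ dragged by `3 * π / n` across handle ⟨i, hiA⟩
    have hφ₁ : (3 * π / n : ℝ) ≠ 0 := (by positivity : (0 : ℝ) < 3 * π / n).ne'
    have hφ₁' : |(3 * π / n : ℝ)| < 2 * π := by
      rw [abs_of_pos (by positivity), div_lt_iff₀ hnpos]; nlinarith [Real.pi_pos, hn2r]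
    have hφ₁pos : (0 : ℝ) < 3 * π / n := by positivity
    obtain ⟨X₁, _, _, _, _, _, _, h₁, D₁, G₁, hpg₁, hsh₁, htw₁, hseam₁, hbelt₁⟩ :=
      node_N1_move g n X bX Ψ X (Diffeomorph.refl (𝓡∂ 4) X ∞) h D (fun k : Fin n => pageDir n ↑k) v s
        (fun k => norm_pageDir n k) hpage_k hshadow htw hseam0 hbelt0 ⟨i + 1, hi⟩ (3 * π / n)
        (some ⟨i, hiA⟩) hφ₁ hφ₁'
        (fun k hk0 hkc t ht heq => free_move1 hi k hk0 (fun c => hkc (by rw [c])) ht heq)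
        (fun k₁ hk₁ => by
          obtain rfl : (⟨i, hiA⟩ : Fin n) = k₁ := Option.some_injective _ hk₁
          exact ⟨hAB, 2 / 3, ⟨by norm_num, by norm_num⟩, cross_move1 hi⟩)
    have hd₁ : ∀ k, ‖Function.update (fun k : Fin n => pageDir n ↑k) ⟨i + 1, hi⟩ (pageDir n (i + 1) * Complex.exp (((3 * π / n : ℝ) : ℂ) * Complex.I)) k‖ = 1 := by
      intro k
      by_cases hk : k = ⟨i + 1, hi⟩
      · subst hk
        rw [Function.update_self, norm_mul, norm_pageDir, Complex.norm_exp_ofReal_mul_I, mul_one]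
      · rw [Function.update_of_ne hk, norm_pageDir]
    have hshadows₁ : ∀ k, shadow g (h₁ k).attachingCircle (h₁ k).continuous_attachingCircle = Function.update v ⟨i + 1, hi⟩ (transvection (stdSymp ℤ g) (v ⟨i, hiA⟩, s ⟨i, hiA⟩) (v ⟨i + 1, hi⟩)) k := by
      intro k; rw [hsh₁ k]; simp only [Option.elim_some, if_pos hφ₁pos]
    -- MOVE 2: handle ⟨i, hiA⟩ rotated freely by `-(2 * π / n)`
    have hφ₂ : (-(2 * π / n) : ℝ) ≠ 0 := neg_ne_zero.2 (by positivity : (0 : ℝ) < 2 * π / n).ne'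
    have hφ₂' : |(-(2 * π / n) : ℝ)| < 2 * π := by
      rw [abs_neg, abs_of_pos (by positivity), div_lt_iff₀ hnpos]; nlinarith [Real.pi_pos, hn2r]
    obtain ⟨X₂, _, _, _, _, _, _, h₂, D₂, G₂, hpg₂, hsh₂, htw₂, hseam₂, hbelt₂⟩ :=
      node_N1_move g n X bX Ψ X₁ ((Diffeomorph.refl (𝓡∂ 4) X ∞).trans G₁) h₁ D₁
        (Function.update (fun k : Fin n => pageDir n ↑k) ⟨i + 1, hi⟩ (pageDir n (i + 1) * Complex.exp (((3 * π / n : ℝ) : ℂ) * Complex.I))) (Function.update v ⟨i + 1, hi⟩ (transvection (stdSymp ℤ g) (v ⟨i, hiA⟩, s ⟨i, hiA⟩) (v ⟨i + 1, hi⟩))) s hd₁ hpg₁ hshadows₁ htw₁ hseam₁ hbelt₁ ⟨i, hiA⟩ (-(2 * π / n)) none hφ₂ hφ₂'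
        (fun k hk0 _ t ht heq => by
          rw [Function.update_of_ne hAB] at heq
          by_cases hk : k = ⟨i + 1, hi⟩
          · subst hk
            rw [Function.update_self] at heq
            exact free_move2_B hi ht heq
          · rw [Function.update_of_ne hk] at heq
            exact free_move2_O hi k hk hk0 ht heq)
        (fun k₁ hk₁ => (Option.some_ne_none k₁ hk₁.symm).elim)
    have hd₂ : ∀ k, ‖Function.update (Function.update (fun k : Fin n => pageDir n ↑k) ⟨i + 1, hi⟩ (pageDir n (i + 1) * Complex.exp (((3 * π / n : ℝ) : ℂ) * Complex.I))) ⟨i, hiA⟩ ((Function.update (fun k : Fin n => pageDir n ↑k) ⟨i + 1, hi⟩ (pageDir n (i + 1) * Complex.exp (((3 * π / n : ℝ) : ℂ) * Complex.I))) ⟨i, hiA⟩ * Complex.exp (((-(2 * π / n) : ℝ) : ℂ) * Complex.I)) k‖ = 1 := by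
      intro k
      by_cases hk : k = ⟨i, hiA⟩
      · subst hk
        rw [Function.update_self, norm_mul, hd₁, Complex.norm_exp_ofReal_mul_I, mul_one]
      · rw [Function.update_of_ne hk]
        exact hd₁ k
    have hshadows₂ : ∀ k, shadow g (h₂ k).attachingCircle (h₂ k).continuous_attachingCircle = Function.update v ⟨i + 1, hi⟩ (transvection (stdSymp ℤ g) (v ⟨i, hiA⟩, s ⟨i, hiA⟩) (v ⟨i + 1, hi⟩)) k := by
      intro k; rw [hsh₂ k, Option.elim_none, Function.update_eq_self]
    -- MOVE 3: handle ⟨i + 1, hi⟩ rotated freely by `-(π / n)`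
    have hφ₃ : (-(π / n) : ℝ) ≠ 0 := neg_ne_zero.2 (by positivity : (0 : ℝ) < π / n).ne'
    have hφ₃' : |(-(π / n) : ℝ)| < 2 * π := by
      rw [abs_neg, abs_of_pos (by positivity), div_lt_iff₀ hnpos]; nlinarith [Real.pi_pos, hn2r]
    obtain ⟨X₃, _, _, _, _, _, _, h₃, D₃, G₃, hpg₃, hsh₃, htw₃, hseam₃, -⟩ :=
      node_N1_move g n X bX Ψ X₂ (((Diffeomorph.refl (𝓡∂ 4) X ∞).trans G₁).trans G₂) h₂ D₂
        (Function.update (Function.update (fun k : Fin n => pageDir n ↑k) ⟨i + 1, hi⟩ (pageDir n (i + 1) * Complex.exp (((3 * π / n : ℝ) : ℂ) * Complex.I))) ⟨i, hiA⟩ ((Function.update (fun k : Fin n => pageDir n ↑k) ⟨i + 1, hi⟩ (pageDir n (i + 1) * Complex.exp (((3 * π / n : ℝ) : ℂ) * Complex.I))) ⟨i, hiA⟩ * Complex.exp (((-(2 * π / n) : ℝ) : ℂ) * Complex.I))) (Function.update v ⟨i + 1, hi⟩ (transvection (stdSymp ℤ g) (v ⟨i, hiA⟩, s ⟨i, hiA⟩)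 (v ⟨i + 1, hi⟩))) s hd₂ hpg₂ hshadows₂ htw₂ hseam₂ hbelt₂ ⟨i + 1, hi⟩ (-(π / n)) none hφ₃ hφ₃'
        (fun k hk0 _ t ht heq => by
          rw [Function.update_of_ne hBA, Function.update_self] at heq
          by_cases hk : k = ⟨i, hiA⟩
          · subst hk
            rw [Function.update_self, Function.update_of_ne hAB] at heq
            exact free_move3_A hi ht heq
          · rw [Function.update_of_ne hk, Function.update_of_ne hk0] at heq
            exact free_move3_O hi k hk0 hk ht heq)
        (fun k₁ hk₁ => (Option.some_ne_none k₁ hk₁.symm).elim)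
    -- OUTPUT
    refine ⟨X₃, ‹_›, ‹_›, ‹_›, ‹_›, ‹_›, ‹_›, h₃, D₃,
      ((((Diffeomorph.refl (𝓡∂ 4) X ∞).trans G₁).trans G₂).trans G₃), ?_, ?_, ?_, ?_, ?_, ?_, htw₃, hseam₃⟩
    · intro k h1 h2 θ
      have hkA : k ≠ ⟨i, hiA⟩ := fun c => h1 (congrArg Fin.val c)
      have hkB : k ≠ ⟨i + 1, hi⟩ := fun c => h2 (congrArg Fin.val c)
      have hm := hpg₃ k θ
      rw [Function.update_of_ne hkB, Function.update_of_ne hkA, Function.update_of_ne hkB] at hm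
      exact hm
    · intro θ
      have hm := hpg₃ ⟨i + 1, hi⟩ θ
      rw [Function.update_self, Function.update_of_ne hBA, Function.update_self, dir_move3 hi] at hm
      exact hm
    · intro θ
      have hm := hpg₃ ⟨i, hiA⟩ θ
      rw [Function.update_of_ne hAB, Function.update_self, Function.update_of_ne hAB] at hm
      have e := dir_move2 hi
      exact e ▸ hm
    · intro k h1 h2
      have hkB : k ≠ ⟨i + 1, hi⟩ := fun c => h2 (congrArg Fin.val c)
      rw [hsh₃ k, Option.elim_none, Function.update_eq_self, Function.update_of_ne hkB]
    · rw [hsh₃, Option.elim_none, Function.update_eq_self, Function.update_self, if_pos rfl]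
    · rw [hsh₃, Option.elim_none, Function.update_eq_self, Function.update_of_ne hAB, if_pos rfl]
  | false =>
    -- MOVE 1: handle ⟨i, hiA⟩ dragged by `-(3 * π / n)` across handle ⟨i + 1, hi⟩
    have hφ₁ : (-(3 * π / n) : ℝ) ≠ 0 := neg_ne_zero.2 (by positivity : (0 : ℝ) < 3 * π / n).ne'
    have hφ₁' : |(-(3 * π / n) : ℝ)| < 2 * π := by
      rw [abs_neg, abs_of_pos (by positivity), div_lt_iff₀ hnpos]; nlinarith [Real.pi_pos, hn2r]
    have hφ₁neg : ¬ (0 : ℝ) < -(3 * π / n) := by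
      have h3 : (0 : ℝ) < 3 * π / n := by positivity
      linarith
    obtain ⟨X₁, _, _, _, _, _, _, h₁, D₁, G₁, hpg₁, hsh₁, htw₁, hseam₁, hbelt₁⟩ :=
      node_N1_move g n X bX Ψ X (Diffeomorph.refl (𝓡∂ 4) X ∞) h D (fun k : Fin n => pageDir n ↑k) v s
        (fun k => norm_pageDir n k) hpage_k hshadow htw hseam0 hbelt0 ⟨i, hiA⟩ (-(3 * π / n))
        (some ⟨i + 1, hi⟩) hφ₁ hφ₁'
        (fun k hk0 hkc t ht heq => free_move1' hi k hk0 (fun c => hkc (by rw [c])) ht heq)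
        (fun k₁ hk₁ => by
          obtain rfl : (⟨i + 1, hi⟩ : Fin n) = k₁ := Option.some_injective _ hk₁
          exact ⟨hBA, 2 / 3, ⟨by norm_num, by norm_num⟩, cross_move1' hi⟩)
    have hd₁ : ∀ k, ‖Function.update (fun k : Fin n => pageDir n ↑k) ⟨i, hiA⟩ (pageDir n i * Complex.exp (((-(3 * π / n) : ℝ) : ℂ) * Complex.I)) k‖ = 1 := by
      intro k
      by_cases hk : k = ⟨i, hiA⟩
      · subst hk
        rw [Function.update_self, norm_mul, norm_pageDir, Complex.norm_exp_ofReal_mul_I, mul_one]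
      · rw [Function.update_of_ne hk, norm_pageDir]
    have hshadows₁ : ∀ k, shadow g (h₁ k).attachingCircle (h₁ k).continuous_attachingCircle = Function.update v ⟨i, hiA⟩ (transvection (stdSymp ℤ g) (v ⟨i + 1, hi⟩, !s ⟨i + 1, hi⟩) (v ⟨i, hiA⟩)) k := by
      intro k; rw [hsh₁ k]; simp only [Option.elim_some, if_neg hφ₁neg]
    -- MOVE 2: handle ⟨i + 1, hi⟩ rotated freely by `2 * π / n`
    have hφ₂ : (2 * π / n : ℝ) ≠ 0 := (by positivity : (0 : ℝ) < 2 * π / n).ne'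
    have hφ₂' : |(2 * π / n : ℝ)| < 2 * π := by
      rw [abs_of_pos (by positivity), div_lt_iff₀ hnpos]; nlinarith [Real.pi_pos, hn2r]
    obtain ⟨X₂, _, _, _, _, _, _, h₂, D₂, G₂, hpg₂, hsh₂, htw₂, hseam₂, hbelt₂⟩ :=
      node_N1_move g n X bX Ψ X₁ ((Diffeomorph.refl (𝓡∂ 4) X ∞).trans G₁) h₁ D₁
        (Function.update (fun k : Fin n => pageDir n ↑k) ⟨i, hiA⟩ (pageDir n i * Complex.exp (((-(3 * π / n) : ℝ) : ℂ) * Complex.I))) (Function.update v ⟨i, hiA⟩ (transvection (stdSymp ℤ g) (v ⟨i + 1, hi⟩, !s ⟨i + 1, hi⟩) (v ⟨i, hiA⟩))) s hd₁ hpg₁ hshadows₁ htw₁ hseam₁ hbelt₁ ⟨i + 1, hi⟩ (2 * π / n) none hφ₂ hφ₂'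
        (fun k hk0 _ t ht heq => by
          rw [Function.update_of_ne hBA] at heq
          by_cases hk : k = ⟨i, hiA⟩
          · subst hk
            rw [Function.update_self] at heq
            exact free_move2_B' hi ht heq
          · rw [Function.update_of_ne hk] at heq
            exact free_move2_O' hi k hk hk0 ht heq)
        (fun k₁ hk₁ => (Option.some_ne_none k₁ hk₁.symm).elim)
    have hd₂ : ∀ k, ‖Function.update (Function.update (fun k : Fin n => pageDir n ↑k) ⟨i, hiA⟩ (pageDir n i * Complex.exp (((-(3 * π / n) : ℝ) : ℂ) * Complex.I))) ⟨i + 1, hi⟩ ((Function.update (fun k : Fin n => pageDir n ↑k) ⟨i, hiA⟩ (pageDir n i * Complex.exp (((-(3 * π / n) : ℝ) : ℂ) * Complex.I))) ⟨i + 1, hi⟩ * Complex.exp (((2 * π / n : ℝ) : ℂ) * Complex.I)) k‖ = 1 := by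
      intro k
      by_cases hk : k = ⟨i + 1, hi⟩
      · subst hk
        rw [Function.update_self, norm_mul, hd₁, Complex.norm_exp_ofReal_mul_I, mul_one]
      · rw [Function.update_of_ne hk]
        exact hd₁ k
    have hshadows₂ : ∀ k, shadow g (h₂ k).attachingCircle (h₂ k).continuous_attachingCircle = Function.update v ⟨i, hiA⟩ (transvection (stdSymp ℤ g) (v ⟨i + 1, hi⟩, !s ⟨i + 1, hi⟩) (v ⟨i, hiA⟩)) k := by
      intro k; rw [hsh₂ k, Option.elim_none, Function.update_eq_self]
    -- MOVE 3: handle ⟨i, hiA⟩ rotated freely by `π / n`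
    have hφ₃ : (π / n : ℝ) ≠ 0 := (by positivity : (0 : ℝ) < π / n).ne'
    have hφ₃' : |(π / n : ℝ)| < 2 * π := by
      rw [abs_of_pos (by positivity), div_lt_iff₀ hnpos]; nlinarith [Real.pi_pos, hn2r]
    obtain ⟨X₃, _, _, _, _, _, _, h₃, D₃, G₃, hpg₃, hsh₃, htw₃, hseam₃, -⟩ :=
      node_N1_move g n X bX Ψ X₂ (((Diffeomorph.refl (𝓡∂ 4) X ∞).trans G₁).trans G₂) h₂ D₂
        (Function.update (Function.update (fun k : Fin n => pageDir n ↑k) ⟨i, hiA⟩ (pageDir n i * Complex.exp (((-(3 * π / n) : ℝ) : ℂ) * Complex.I))) ⟨i + 1, hi⟩ ((Function.update (fun k : Fin n => pageDir n ↑k) ⟨i, hiA⟩ (pageDir n i * Complex.exp (((-(3 * π / n) : ℝ) : ℂ) * Complex.I))) ⟨i + 1, hi⟩ * Complex.exp (((2 * π / n : ℝ) : ℂ) * Complex.I))) (Function.update v ⟨i, hiA⟩ (transvection (stdSymp ℤ g) (v ⟨i + 1, hi⟩, !s ⟨i + 1, hi⟩) (v ⟨i, hiA⟩))) s hd₂ hpg₂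 hshadows₂ htw₂ hseam₂ hbelt₂ ⟨i, hiA⟩ (π / n) none hφ₃ hφ₃'
        (fun k hk0 _ t ht heq => by
          rw [Function.update_of_ne hAB, Function.update_self] at heq
          by_cases hk : k = ⟨i + 1, hi⟩
          · subst hk
            rw [Function.update_self, Function.update_of_ne hBA] at heq
            exact free_move3_A' hi ht heq
          · rw [Function.update_of_ne hk, Function.update_of_ne hk0] at heq
            exact free_move3_O' hi k hk0 hk ht heq)
        (fun k₁ hk₁ => (Option.some_ne_none k₁ hk₁.symm).elim)
    -- OUTPUT
    refine ⟨X₃, ‹_›, ‹_›, ‹_›, ‹_›, ‹_›, ‹_›, h₃, D₃,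
      ((((Diffeomorph.refl (𝓡∂ 4) X ∞).trans G₁).trans G₂).trans G₃), ?_, ?_, ?_, ?_, ?_, ?_, htw₃, hseam₃⟩
    · intro k h1 h2 θ
      have hkA : k ≠ ⟨i, hiA⟩ := fun c => h1 (congrArg Fin.val c)
      have hkB : k ≠ ⟨i + 1, hi⟩ := fun c => h2 (congrArg Fin.val c)
      have hm := hpg₃ k θ
      rw [Function.update_of_ne hkA, Function.update_of_ne hkB, Function.update_of_ne hkA] at hm
      exact hm
    · intro θ
      have hm := hpg₃ ⟨i + 1, hi⟩ θ
      rw [Function.update_of_ne hBA, Function.update_self, Function.update_of_ne hBA] at hm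
      have e := dir_move2' hi
      exact e ▸ hm
    · intro θ
      have hm := hpg₃ ⟨i, hiA⟩ θ
      rw [Function.update_self, Function.update_of_ne hAB, Function.update_self, dir_move3' hi] at hm
      exact hm
    · intro k h1 h2
      have hkA : k ≠ ⟨i, hiA⟩ := fun c => h1 (congrArg Fin.val c)
      rw [hsh₃ k, Option.elim_none, Function.update_eq_self, Function.update_of_ne hkA]
    · rw [hsh₃, Option.elim_none, Function.update_eq_self, Function.update_of_ne hBA, if_neg Bool.false_ne_true]
    · rw [hsh₃, Option.elim_none, Function.update_eq_self, Function.update_self, if_neg Bool.false_ne_true]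

/-! ## §4 (PROVED) N1-swap ⟹ the transfer form (M2-T) of W6 (`hurwitzStep_of_redecomposition`) -/

/-- **(M2-T) from N1-swap** — unpack the Hurwitz move (`l = pre ++ a :: b :: suf`, positions
`i = |pre|`, `i + 1`), apply the swap with `up :=` the disjunct, re-index the new family and its
data along `Fin l'.length ≃ Fin l.length` (length identity composed with the transposition of the
two positions), and read off `IsLefschetzLink g l' h'`: pages by the swap, shadows and twistings by
computing the letters of `l'` (`transvection_apply`, `sgn (!ε) = −sgn ε`), the seam clause through
`G` unchanged by re-indexing.  The belt clause fed to the swap is V4's `belt_pos`.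
[cite: GompfStipsicz1999, §8.2] -/
theorem n1_transfer :
    ∀ (g : ℕ) (l l' : IntWord g), HurwitzStep (stdSymp ℤ g) l l' →
      ∀ (X : Type) [TopologicalSpace X] [T2Space X] [SecondCountableTopology X] [CompactSpace X]
        [ChartedSpace (EuclideanHalfSpace 4) X] [IsManifold (𝓡∂ 4) ∞ X]
        (h : Fin l.length → HandleAttachingMap 3 2 (Base g))
        (D : MultiAttachmentData h (𝓡∂ 4) X) (bX : BoundaryData (𝓡∂ 4) X (𝓡 3))
        (Ψ : bX.carrier ≃ₘ⟮𝓡 3, 𝓡 3⟯ (bBase g).carrier),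
        IsLefschetzLink g l h →
        (∀ (y : bX.carrier) (a : ↥(coresComplement h)), bX.incl y = D.jA a →
          ∃ c : ℝ, 0 < c ∧ w g ((bBase g).incl (Ψ y)).1 = (c : ℂ) * w g (a : Base g).1) →
        ∃ (X' : Type) (_ : TopologicalSpace X') (_ : T2Space X') (_ : SecondCountableTopology X')
          (_ : CompactSpace X') (_ : ChartedSpace (EuclideanHalfSpace 4) X')
          (_ : IsManifold (𝓡∂ 4) ∞ X') (h' : Fin l'.length → HandleAttachingMap 3 2 (Base g))
          (D' : MultiAttachmentData h' (𝓡∂ 4) X') (G : X ≃ₘ⟮𝓡∂ 4, 𝓡∂ 4⟯ X'),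
          IsLefschetzLink g l' h' ∧
          ∀ (y : bX.carrier) (a' : ↥(coresComplement h')), G (bX.incl y) = D'.jA a' →
            ∃ c : ℝ, 0 < c ∧ w g ((bBase g).incl (Ψ y)).1 = (c : ℂ) * w g (a' : Base g).1 := by
  intro g l l' hst X _ _ _ _ _ _ h D bX Ψ hlink hpage
  obtain ⟨pre, suf, a, b, hl, hl'⟩ := hst
  subst hl
  -- the two positions `iA = |pre|`, `iB = |pre| + 1`
  have hiB : pre.length + 1 < (pre ++ a :: b :: suf).length := by simp
  have hiA : pre.length < (pre ++ a :: b :: suf).length := Nat.lt_of_succ_lt hiB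
  have ha : (pre ++ a :: b :: suf).get ⟨pre.length, hiA⟩ = a := getElem_mid_fst pre suf a b hiA
  have hb : (pre ++ a :: b :: suf).get ⟨pre.length + 1, hiB⟩ = b := getElem_mid_snd pre suf a b hiB
  -- the belt clause (V4) and the swap
  have hbelt : ∀ (y : bX.carrier) (k : Fin (pre ++ a :: b :: suf).length) (b' : ↥(beltPiece 3 2)),
      bX.incl y = D.jB k b' → bX.incl y ∉ range D.jA →
      ∃ c : ℝ, 0 < c ∧ w g ((bBase g).incl (Ψ y)).1 = (c : ℂ) * pageDir (pre ++ a :: b :: suf).length k :=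
    fun y k b' hy hdeep => BeltPageClause.belt_pos D bX Ψ.continuous Ψ.toHomeomorph.isOpenMap
      (hlink.mem_page k) hpage hy hdeep
  have key := fun up : Bool => node_N1_swap g (pre ++ a :: b :: suf).length X h D bX Ψ
    (fun k => ((pre ++ a :: b :: suf).get k).1) (fun k => ((pre ++ a :: b :: suf).get k).2)
    hlink.mem_page hlink.shadow_eq hlink.twisting_eq hpage hbelt pre.length hiB up
  -- the new word, with its disjunct
  have main : ∀ (up : Bool) (x y : (Fin g ⊕ Fin g → ℤ) × Bool),
      x.1 = (if up then transvection (stdSymp ℤ g) (a.1, a.2) b.1 else b.1) →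
      y.1 = (if up then a.1 else transvection (stdSymp ℤ g) (b.1, !b.2) a.1) →
      x.2 = b.2 → y.2 = a.2 →
      ∃ (X' : Type) (_ : TopologicalSpace X') (_ : T2Space X') (_ : SecondCountableTopology X')
        (_ : CompactSpace X') (_ : ChartedSpace (EuclideanHalfSpace 4) X')
        (_ : IsManifold (𝓡∂ 4) ∞ X')
        (h' : Fin (pre ++ x :: y :: suf).length → HandleAttachingMap 3 2 (Base g))
        (D' : MultiAttachmentData h' (𝓡∂ 4) X') (G : X ≃ₘ⟮𝓡∂ 4, 𝓡∂ 4⟯ X'),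
        IsLefschetzLink g (pre ++ x :: y :: suf) h' ∧
        ∀ (yy : bX.carrier) (a' : ↥(coresComplement h')), G (bX.incl yy) = D'.jA a' →
          ∃ c : ℝ, 0 < c ∧ w g ((bBase g).incl (Ψ yy)).1 = (c : ℂ) * w g (a' : Base g).1 := by
    intro up x y hx1 hy1 hx2 hy2
    obtain ⟨X', _, _, _, _, _, _, h', D', G, hpO, hpB, hpA, hshO, hshB, hshA, htw', hseam'⟩ :=
      key up
    have hlen : (pre ++ x :: y :: suf).length = (pre ++ a :: b :: suf).length := by simp
    -- re-indexing: length identity then the transposition of the two positions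
    obtain ⟨e, he⟩ : ∃ e : Fin (pre ++ x :: y :: suf).length ≃ Fin (pre ++ a :: b :: suf).length,
        e = (finCongr hlen).trans (Equiv.swap ⟨pre.length, hiA⟩ ⟨pre.length + 1, hiB⟩) := ⟨_, rfl⟩
    have hAB : (⟨pre.length, hiA⟩ : Fin (pre ++ a :: b :: suf).length) ≠ ⟨pre.length + 1, hiB⟩ := by
      intro c; have := congrArg Fin.val c; simp at this
    have heA : ∀ j : Fin (pre ++ x :: y :: suf).length, j.1 = pre.length →
        e j = ⟨pre.length + 1, hiB⟩ := by
      intro j hj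
      have : finCongr hlen j = ⟨pre.length, hiA⟩ := Fin.ext hj
      rw [he, Equiv.trans_apply, this, Equiv.swap_apply_left]
    have heB : ∀ j : Fin (pre ++ x :: y :: suf).length, j.1 = pre.length + 1 →
        e j = ⟨pre.length, hiA⟩ := by
      intro j hj
      have : finCongr hlen j = ⟨pre.length + 1, hiB⟩ := Fin.ext hj
      rw [he, Equiv.trans_apply, this, Equiv.swap_apply_right]
    have heO : ∀ j : Fin (pre ++ x :: y :: suf).length, j.1 ≠ pre.length → j.1 ≠ pre.length + 1 →
        e j = ⟨j.1, hlen ▸ j.2⟩ := by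
      intro j h1 h2
      have h1' : finCongr hlen j ≠ ⟨pre.length, hiA⟩ := fun c => h1 (congrArg Fin.val c)
      have h2' : finCongr hlen j ≠ ⟨pre.length + 1, hiB⟩ := fun c => h2 (congrArg Fin.val c)
      rw [he, Equiv.trans_apply, Equiv.swap_apply_of_ne_of_ne h1' h2']
      rfl
    -- the entries of the two words
    have hxj : ∀ j : Fin (pre ++ x :: y :: suf).length, j.1 = pre.length →
        (pre ++ x :: y :: suf).get j = x := by
      intro j hj
      rw [List.get_eq_getElem]
      simp only [hj]
      exact getElem_mid_fst pre suf x y (hj ▸ j.2)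
    have hyj : ∀ j : Fin (pre ++ x :: y :: suf).length, j.1 = pre.length + 1 →
        (pre ++ x :: y :: suf).get j = y := by
      intro j hj
      rw [List.get_eq_getElem]
      simp only [hj]
      exact getElem_mid_snd pre suf x y (hj ▸ j.2)
    have hoj : ∀ j : Fin (pre ++ x :: y :: suf).length, j.1 ≠ pre.length → j.1 ≠ pre.length + 1 →
        (pre ++ x :: y :: suf).get j = (pre ++ a :: b :: suf).get ⟨j.1, hlen ▸ j.2⟩ := by
      intro j h1 h2
      rw [List.get_eq_getElem, List.get_eq_getElem]
      rcases Nat.lt_or_ge j.1 pre.length with hlt | hge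
      · exact getElem_mid_left pre suf x y a b hlt _ _
      · exact getElem_mid_right pre suf x y a b (by omega) _ _
    refine ⟨X', ‹_›, ‹_›, ‹_›, ‹_›, ‹_›, ‹_›, h' ∘ e, reindexData D' e, G, ⟨?_, ?_, ?_, ?_⟩, ?_⟩
    · exact (reindexData D' e).disjoint
    · -- pages
      intro j θ
      have hdir : pageDir (pre ++ x :: y :: suf).length j.1 = pageDir (pre ++ a :: b :: suf).length j.1 :=
        congrArg (fun m => pageDir m j.1) hlen
      rw [hdir, Function.comp_apply]
      by_cases h1 : j.1 = pre.length
      · rw [heA j h1, h1]; exact hpB θ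
      by_cases h2 : j.1 = pre.length + 1
      · rw [heB j h2, h2]; exact hpA θ
      · rw [heO j h1 h2]; exact hpO ⟨j.1, hlen ▸ j.2⟩ h1 h2 θ
    · -- shadows
      intro j
      by_cases h1 : j.1 = pre.length
      · have hj : (h' ∘ ⇑e) j = h' ⟨pre.length + 1, hiB⟩ := by rw [Function.comp_apply, heA j h1]
        rw [hj, hshB, hxj j h1, hx1, ha, hb]
      by_cases h2 : j.1 = pre.length + 1
      · have hj : (h' ∘ ⇑e) j = h' ⟨pre.length, hiA⟩ := by rw [Function.comp_apply, heB j h2]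
        rw [hj, hshA, hyj j h2, hy1, ha, hb]
      · have hj : (h' ∘ ⇑e) j = h' ⟨j.1, hlen ▸ j.2⟩ := by rw [Function.comp_apply, heO j h1 h2]
        rw [hj, hshO ⟨j.1, hlen ▸ j.2⟩ h1 h2, hoj j h1 h2]
    · -- twistings
      intro j
      by_cases h1 : j.1 = pre.length
      · have hj : (h' ∘ ⇑e) j = h' ⟨pre.length + 1, hiB⟩ := by rw [Function.comp_apply, heA j h1]
        rw [hj, htw', hxj j h1, hx2, hb]
      by_cases h2 : j.1 = pre.length + 1
      · have hj : (h' ∘ ⇑e) j = h' ⟨pre.length, hiA⟩ := by rw [Function.comp_apply, heB j h2]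
        rw [hj, htw', hyj j h2, hy2, ha]
      · have hj : (h' ∘ ⇑e) j = h' ⟨j.1, hlen ▸ j.2⟩ := by rw [Function.comp_apply, heO j h1 h2]
        rw [hj, htw', hoj j h1 h2]
    · -- the seam clause through `G` survives re-indexing (same base points)
      intro yy a' hy
      rw [reindexData_jA] at hy
      exact hseam' yy ⟨(a' : Base g), (mem_coresComplement_comp_iff e.surjective).1 a'.2⟩ hy
  rcases hl' with rfl | rfl
  · have hx1 : (b.1 + (sgn a.2 * stdSymp ℤ g a.1 b.1) • a.1, b.2).1 =
        (if true then transvection (stdSymp ℤ g) (a.1, a.2) b.1 else b.1) := by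
      rw [if_pos rfl, transvection_apply]
    have hy1 : a.1 = (if true then a.1 else transvection (stdSymp ℤ g) (b.1, !b.2) a.1) := by
      rw [if_pos rfl]
    exact main true (b.1 + (sgn a.2 * stdSymp ℤ g a.1 b.1) • a.1, b.2) a hx1 hy1 rfl rfl
  · have hx1 : b.1 = (if false then transvection (stdSymp ℤ g) (a.1, a.2) b.1 else b.1) := by
      rw [if_neg Bool.false_ne_true]
    have hy1 : (a.1 - (sgn b.2 * stdSymp ℤ g b.1 a.1) • b.1, a.2).1 =
        (if false then a.1 else transvection (stdSymp ℤ g) (b.1, !b.2) a.1) := by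
      rw [if_neg Bool.false_ne_true, transvection_apply, ModelsOnFibredOfReach.sgn_not, neg_mul, neg_smul,
        sub_eq_add_neg]
    exact main false b (a.1 - (sgn b.2 * stdSymp ℤ g b.1 a.1) • b.1, a.2) hx1 hy1 rfl rfl

/-! ## §5 (PROVED) (M2-T) ⟹ (M2-geo) = the REGISTERED text of `stub_M2geo`; (HS) check -/

/-- **(M2-geo) from (M2-T)**: the seam clause through `G` for the new data, together with the OLD
seam clause (hypothesis) and the OLD belt clause (V4 `belt_pos`), gives the seam/belt dichotomy for
`G⁻¹` on the new seam: the point `G⁻¹ (D'.jA a') ∈ ∂X` is `bX.incl y`, and by `D.cover` it is an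
old seam point `D.jA a` (same `w`-ray: both angles equal that of `Ψ y`) or an old deep belt point
`D.jB k b ∉ range D.jA` (angle `pageDir n k` by V4). [folklore] -/
theorem m2geo_of_transfer
    (hT : ∀ (g : ℕ) (l l' : IntWord g), HurwitzStep (stdSymp ℤ g) l l' →
      ∀ (X : Type) [TopologicalSpace X] [T2Space X] [SecondCountableTopology X] [CompactSpace X]
        [ChartedSpace (EuclideanHalfSpace 4) X] [IsManifold (𝓡∂ 4) ∞ X]
        (h : Fin l.length → HandleAttachingMap 3 2 (Base g))
        (D : MultiAttachmentData h (𝓡∂ 4) X) (bX : BoundaryData (𝓡∂ 4) X (𝓡 3))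
        (Ψ : bX.carrier ≃ₘ⟮𝓡 3, 𝓡 3⟯ (bBase g).carrier),
        IsLefschetzLink g l h →
        (∀ (y : bX.carrier) (a : ↥(coresComplement h)), bX.incl y = D.jA a →
          ∃ c : ℝ, 0 < c ∧ w g ((bBase g).incl (Ψ y)).1 = (c : ℂ) * w g (a : Base g).1) →
        ∃ (X' : Type) (_ : TopologicalSpace X') (_ : T2Space X') (_ : SecondCountableTopology X')
          (_ : CompactSpace X') (_ : ChartedSpace (EuclideanHalfSpace 4) X')
          (_ : IsManifold (𝓡∂ 4) ∞ X') (h' : Fin l'.length → HandleAttachingMap 3 2 (Base g))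
          (D' : MultiAttachmentData h' (𝓡∂ 4) X') (G : X ≃ₘ⟮𝓡∂ 4, 𝓡∂ 4⟯ X'),
          IsLefschetzLink g l' h' ∧
          ∀ (y : bX.carrier) (a' : ↥(coresComplement h')), G (bX.incl y) = D'.jA a' →
            ∃ c : ℝ, 0 < c ∧ w g ((bBase g).incl (Ψ y)).1 = (c : ℂ) * w g (a' : Base g).1) :
    ∀ (g : ℕ) (l l' : Literature.GroupTheory.CombinatorialGroupTheory.SignedHurwitz.IntWord g), Literature.GroupTheory.CombinatorialGroupTheory.SignedHurwitz.HurwitzStep (Literature.GroupTheory.CombinatorialGroupTheory.SignedHurwitz.stdSymp ℤ g) l l' → ∀ (X : Type) [TopologicalSpace X] [T2Space X] [SecondCountableTopology X] [CompactSpace X] [ChartedSpace (EuclideanHalfSpace 4) X] [IsManifold (𝓡∂ 4) ∞ X] (h : Fin l.length → Literature.Topology.FourManifolds.HandleAttachingMap 3 2 (Literature.Topology.FourManifolds.LefschetzBase.Base g)) (D : Literature.Topology.FourManifolds.HandleAttachingMap.MultiAttachmentData h (𝓡∂ 4) X) (bX : Literature.Topology.FourManifolds.BoundaryData (𝓡∂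 4) X (𝓡 3)) (Ψ : bX.carrier ≃ₘ⟮𝓡 3, 𝓡 3⟯ (Literature.Topology.FourManifolds.LefschetzBase.bBase g).carrier), Literature.Topology.FourManifolds.LefschetzBase.IsLefschetzLink g l h → (∀ (y : bX.carrier) (a : ↥(Literature.Topology.FourManifolds.HandleAttachingMap.coresComplement h)), bX.incl y = D.jA a → ∃ c : ℝ, 0 < c ∧ Literature.Topology.FourManifolds.LefschetzBase.w g ((Literature.Topology.FourManifolds.LefschetzBase.bBase g).incl (Ψ y)).1 = (c : ℂ) * Literature.Topology.FourManifolds.LefschetzBase.w g (a : Literature.Topology.FourManifolds.LefschetzBase.Base g).1) → ∃ (X' : Type) (_ : TopologicalSpace X') (_ : T2Space X') (_ : SecondCountableTopology X') (_ : CompactSpace X') (_ : ChartedSpace (EuclideanHalfSpace 4) X') (_ : IsManifold (𝓡∂ 4) ∞ X') (h' : Fin l'.length → Literature.Topology.FourManifolds.HandleAttachingMap 3 2 (Literature.Topology.FourManifolds.LefschetzBase.Base g)) (D' : Literature.Topology.FourManifolds.HandleAttachingMap.MultiAttachmentData h' (𝓡∂ 4) X') (G : X ≃ₘ⟮𝓡∂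 4, 𝓡∂ 4⟯ X'), Literature.Topology.FourManifolds.LefschetzBase.IsLefschetzLink g l' h' ∧ ∀ a' : ↥(Literature.Topology.FourManifolds.HandleAttachingMap.coresComplement h'), G.symm (D'.jA a') ∈ (𝓡∂ 4).boundary X → (∃ a : ↥(Literature.Topology.FourManifolds.HandleAttachingMap.coresComplement h), G.symm (D'.jA a') = D.jA a ∧ ∃ c : ℝ, 0 < c ∧ Literature.Topology.FourManifolds.LefschetzBase.w g (a' : Literature.Topology.FourManifolds.LefschetzBase.Base g).1 = (c : ℂ) * Literature.Topology.FourManifolds.LefschetzBase.w g (a : Literature.Topology.FourManifolds.LefschetzBase.Base g).1) ∨ (∃ (k : Fin l.length) (b : ↥(Literature.Topology.FourManifolds.beltPiece 3 2)), G.symm (D'.jA a') = D.jB k b ∧ G.symm (D'.jA a') ∉ Set.range D.jA ∧ ∃ c : ℝ, 0 < c ∧ Literature.Topology.FourManifolds.LefschetzBase.w g (a' : Literature.Topology.FourManifolds.LefschetzBase.Base g).1 = (c : ℂ) * Literature.Topology.FourManifolds.LefschetzBase.pageDir l.length k) := by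
  intro g l l' hst X _ _ _ _ _ _ h D bX Ψ hlink hpage
  obtain ⟨X', _, _, _, _, _, _, h', D', G, hlink', hseam'⟩ := hT g l l' hst X h D bX Ψ hlink hpage
  refine ⟨X', ‹_›, ‹_›, ‹_›, ‹_›, ‹_›, ‹_›, h', D', G, hlink', fun a' ha' => ?_⟩
  -- the point of `∂X` under the new seam point
  obtain ⟨y, hy⟩ : G.symm (D'.jA a') ∈ range bX.incl := by rw [bX.range_incl]; exact ha'
  have hGy : G (bX.incl y) = D'.jA a' := by rw [hy, Diffeomorph.apply_symm_apply]
  obtain ⟨c', hc', hw'⟩ := hseam' y a' hGy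
  have hc'0 : (c' : ℂ) ≠ 0 := by exact_mod_cast hc'.ne'
  -- old seam points: same ray
  have seam : ∀ a : ↥(coresComplement h), bX.incl y = D.jA a →
      (∃ a : ↥(coresComplement h), G.symm (D'.jA a') = D.jA a ∧
        ∃ c : ℝ, 0 < c ∧ w g (a' : Base g).1 = (c : ℂ) * w g (a : Base g).1) := by
    intro a ha
    obtain ⟨c, hc, hw⟩ := hpage y a ha
    refine ⟨a, hy ▸ ha, c / c', div_pos hc hc', ?_⟩
    have e : w g (a' : Base g).1 = (c' : ℂ)⁻¹ * w g ((bBase g).incl (Ψ y)).1 := by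
      rw [hw', ← mul_assoc, inv_mul_cancel₀ hc'0, one_mul]
    rw [e, hw, ← mul_assoc]
    congr 1
    push_cast
    field_simp
  rcases D.mem_range_or (bX.incl y) with ⟨a, ha⟩ | ⟨k, b, hb⟩
  · exact Or.inl (seam a ha.symm)
  · by_cases hr : bX.incl y ∈ range D.jA
    · obtain ⟨a, ha⟩ := hr
      exact Or.inl (seam a ha.symm)
    · right
      obtain ⟨c, hc, hw⟩ := BeltPageClause.belt_pos D bX Ψ.continuous Ψ.toHomeomorph.isOpenMap
        (hlink.mem_page k) hpage hb.symm hr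
      refine ⟨k, b, by rw [← hy, hb], by rw [← hy]; exact hr, c / c', div_pos hc hc', ?_⟩
      have e : w g (a' : Base g).1 = (c' : ℂ)⁻¹ * w g ((bBase g).incl (Ψ y)).1 := by
        rw [hw', ← mul_assoc, inv_mul_cancel₀ hc'0, one_mul]
      rw [e, hw, ← mul_assoc]
      congr 1
      push_cast
      field_simp

/-- **TOP — the registered text of `stub_M2geo` (= W6's `node_M2geo`, `sig_stub_M2geo.txt`
VERBATIM), PROVED from the nodes**: `m2geo_of_transfer n1_transfer`.
[cite: GompfStipsicz1999, §8.2] -/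
theorem n1_design : ∀ (g : ℕ) (l l' : Literature.GroupTheory.CombinatorialGroupTheory.SignedHurwitz.IntWord g), Literature.GroupTheory.CombinatorialGroupTheory.SignedHurwitz.HurwitzStep (Literature.GroupTheory.CombinatorialGroupTheory.SignedHurwitz.stdSymp ℤ g) l l' → ∀ (X : Type) [TopologicalSpace X] [T2Space X] [SecondCountableTopology X] [CompactSpace X] [ChartedSpace (EuclideanHalfSpace 4) X] [IsManifold (𝓡∂ 4) ∞ X] (h : Fin l.length → Literature.Topology.FourManifolds.HandleAttachingMap 3 2 (Literature.Topology.FourManifolds.LefschetzBase.Base g)) (D : Literature.Topology.FourManifolds.HandleAttachingMap.MultiAttachmentData h (𝓡∂ 4) X) (bX : Literature.Topology.FourManifolds.BoundaryData (𝓡∂ 4) X (𝓡 3)) (Ψ : bX.carrier ≃ₘ⟮𝓡 3, 𝓡 3⟯ (Literature.Topology.FourManifolds.LefschetzBase.bBase g).carrier), Literature.Topology.FourManifolds.LefschetzBase.IsLefschetzLink g l h → (∀ (y : bX.carrier) (a : ↥(Literature.Topology.FourManifolds.HandleAttachingMap.coresComplement h)), bX.incl y = D.jA a → ∃ c : ℝ,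 0 < c ∧ Literature.Topology.FourManifolds.LefschetzBase.w g ((Literature.Topology.FourManifolds.LefschetzBase.bBase g).incl (Ψ y)).1 = (c : ℂ) * Literature.Topology.FourManifolds.LefschetzBase.w g (a : Literature.Topology.FourManifolds.LefschetzBase.Base g).1) → ∃ (X' : Type) (_ : TopologicalSpace X') (_ : T2Space X') (_ : SecondCountableTopology X') (_ : CompactSpace X') (_ : ChartedSpace (EuclideanHalfSpace 4) X') (_ : IsManifold (𝓡∂ 4) ∞ X') (h' : Fin l'.length → Literature.Topology.FourManifolds.HandleAttachingMap 3 2 (Literature.Topology.FourManifolds.LefschetzBase.Base g)) (D' : Literature.Topology.FourManifolds.HandleAttachingMap.MultiAttachmentData h' (𝓡∂ 4) X') (G : X ≃ₘ⟮𝓡∂ 4, 𝓡∂ 4⟯ X'), Literature.Topology.FourManifolds.LefschetzBase.IsLefschetzLink g l' h' ∧ ∀ a' : ↥(Literature.Topology.FourManifolds.HandleAttachingMap.coresComplement h'), G.symm (D'.jA a') ∈ (𝓡∂ 4).boundary X → (∃ a : ↥(Literature.Topology.FourManifolds.HandleAttachingMap.coresComplement h), G.symm (D'.jA a') = D.jA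 a ∧ ∃ c : ℝ, 0 < c ∧ Literature.Topology.FourManifolds.LefschetzBase.w g (a' : Literature.Topology.FourManifolds.LefschetzBase.Base g).1 = (c : ℂ) * Literature.Topology.FourManifolds.LefschetzBase.w g (a : Literature.Topology.FourManifolds.LefschetzBase.Base g).1) ∨ (∃ (k : Fin l.length) (b : ↥(Literature.Topology.FourManifolds.beltPiece 3 2)), G.symm (D'.jA a') = D.jB k b ∧ G.symm (D'.jA a') ∉ Set.range D.jA ∧ ∃ c : ℝ, 0 < c ∧ Literature.Topology.FourManifolds.LefschetzBase.w g (a' : Literature.Topology.FourManifolds.LefschetzBase.Base g).1 = (c : ℂ) * Literature.Topology.FourManifolds.LefschetzBase.pageDir l.length k) :=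
  m2geo_of_transfer n1_transfer

/-- **(HS) check**: the consumer `hurwitzStep_of_redecomposition` (p134969) is fed DIRECTLY by the
transfer form — fibred models of closed manifolds survive one signed Hurwitz move.
[cite: GompfStipsicz1999, §8.2] -/
theorem hs_of_n1 :
    ∀ (M : Type) [TopologicalSpace M] [T2Space M] [SecondCountableTopology M]
      [ChartedSpace (EuclideanSpace ℝ (Fin 4)) M] [IsManifold (𝓡 4) ∞ M] (g : ℕ) (l l' : IntWord g),
      ModelsOnFibred M g l → HurwitzStep (stdSymp ℤ g) l l' → ModelsOnFibred M g l' :=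
  hurwitzStep_of_redecomposition n1_transfer

end N1Design

end Summit.SmoothPoincare4.SmoothPoincare4.Theorems.AcyclicBisectionExists.ModpBraidOrbits

end
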